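import Summits.AnomalousDissipation.AnomalousDissipation.Theorems.SolenoidalFractalHomogenisationLagrangianStepCellLawVOddGainDefectStrict
import HarnessLib

/-!
# K1L `LagrangianRenormalisationStep(Design)` (K1L_D, stmt-AnomalousDissipation-27980; aside 24912), stub `stub_cellLawV0_IS`
# — W5 odd half, §5–§7: THE WINDOW CLAUSE FOR SECTORIAL BLOCKS — the UPPER edge in full (no symmetry), the skew bound, and (§6–§7, v4)
# the LOWER edge PROVED to first order in `τ`: `vᵀ f_T(B) v ≥ (f_T(hi) − (τhi/2)·g_T(lo))·|v|²` — the typed target `LowerEdgeTarget` itself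
# (`lowerEdgeTarget_holds`; §6 = the `√`-free version with constant `√e`, `lowerEdgeTargetE_holds`); and (§8, v5) a PROVED LOSSY SUBSTITUTE
# for the sector-preservation hypothesis L1⁺: `f_T(B)` is `τ·θ`-sectorial, `θ = hi·g_T(lo)/(f_T(hi) − (τhi/2)g_T(lo))` (`lossySectorTarget_holds`);
# and (§9, v6) the EXACT L1⁺ (`θ ≤ 1`, branch B) reduced to ONE typed analytic identity `CosineMixture ρ`: the resolvent atoms `C(C²+s)⁻¹` are
# sector-safe (`sector_resolventAtom`, PROVED) and `sectorPreservation_of_cosineMixture` (PROVED)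

Summits-side helper/sketch of route `SolenoidalFractalHomogenisation` (planner ad-ideate-p5 g8, lens «profile»), on top of `…CellLawVOddGainDefectStrict`
(p650822) and the worker's `…CellLawVSemigroupPerp` (p642614) / `…CellLawVQSResp` (p643071).
The remaining per-slot obligation of the strict twin `oddSectorial_excQS_strict_of_slot` is the transverse window of the quasi-static response
`f_T(B)` of a SECTORIAL (non-symmetric) block `B` with `lo|x|² ≤ xᵀBx ≤ hi|x|²` and Kato sector `τ`.  PROVED here, sorry-free:
* `form_exp_le_of_coercive` — `vᵀe^{−tB}v ≤ e^{−lo t}|v|²` for EVERY block with `lo|x|² ≤ xᵀBx` (contractivity p642614 at `u = 0` + Cauchy–Schwarz);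
* **`qsResp_window_upper`** — hence the UPPER window edge `vᵀ f_T(B) v ≤ f_T(lo)|v|²` holds for sectorial blocks with NO loss (`T ≥ 0`);
* **`skew_sq_le_of_sector`** — the sector hypothesis controls the skew part: `|(B − Bᵀ)z|² ≤ (τ·hi)²|z|²` (test the sector inequality at `x = (B − Bᵀ)z`).
TYPED TARGET (the lower edge, first order in `τ`; statement only, as `def …_Target : Prop`, no sorry, nothing claimed):
* `LowerEdgeTarget ρ` — `∀ T ≥ 0, ∀ B` (window `[lo, hi]`, sector `τ`), `∀ v`, `vᵀ f_T(B) v ≥ (f_T(hi) − (τ·hi/2)·g_T(lo))·|v|²` with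
  `g_T(a) = T∫₀¹a(s)∫₀ˢa(x)·T(s−x)·e^{−T(s−x)a}` (`= −∂_a f_T`); route: energy estimate for `w = e^{−tB}v − e^{−tH}v`, `H = (B+Bᵀ)/2`:
  `|w(t)| ≤ (τhi/2)·t·e^{−lo t}|v|` (uses `skew_sq_le_of_sector`), then the symmetric pinch on `H` and the kernel integration of p643071.
  Relative loss of the lower edge `τ·hi²/(2lo²)` (first order).
* `LowerEdgeTargetSharp ρ` — the SHARP form suggested by the profile: `vᵀ f_T(B) v ≥ f_T(hi)/(1 + τ²/4)·|v|²`.  MEASURED (kit j313542, adversarial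
  search over sectorial blocks, 180 cells): loss of the lower edge `= 0.250·τ²·(1 − O(1/T))` INDEPENDENT of the window (`0.21τ²` at `T = 16`,
  `0.2495τ²` for `T ≥ 100`; at `τ = 0.3` exactly `0.02200 = 1 − 1/(1 + τ²/4)`), extremiser `H = hi·𝟙`, `K` = maximal rotation `(τhi/2)[u]_×`
  (`e^{−tB} = e^{−hi t}R(hiτt/2)`); the upper edge measured `r_hi = 1.00000` in every cell (= `qsResp_window_upper`).  Static-limit proof of the
  sharp constant: `sym((H + K)⁻¹) = H^{−1/2}(𝟙 − A²)⁻¹H^{−1/2} ≥ H⁻¹/(1 + ‖A‖²)`, `A = H^{−1/2}KH^{−1/2}`, `‖A‖ ≤ τ/2`; finite `T` open (the kernel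
  is not Stieltjes).  Either target closes the window clause (`window_clause_of_lowerEdgeTarget(Sharp)`, proved bookkeeping).
§6 (v3, PROVED, sorry-free) — THE LOWER EDGE TO FIRST ORDER WITH CONSTANT `√e ≈ 1.6487`:
* `duhamel_defect_sq_le` — energy estimate for the Duhamel defect `w(t) = e^{−tB}v − e^{−tH}v`, `H = symPart B = (B + Bᵀ)/2`:
  `|w(t)|² ≤ e·(τhi/2)²·t²·e^{−2lo t}|v|²` (`t ≥ 0`).  Mechanism (no square root is differentiated): `|w|²' = −2wᵀBw − 2wᵀK e^{−tH}v
  ≤ (μ − 2lo)|w|² + (τhi/2)²e^{−2lo t}|v|²/μ` (window of `B`, termwise AM–GM, `skewPart_sq_le`, contractivity of `e^{−tH}` from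
  `Literature…sum_sq_exp_neg_smul_mulVec_le`), so `Ψ(s) = e^{(2lo−μ)s}|w(s)|² + (τhi/2)²|v|²e^{−μs}/μ²` is non-increasing on `[0, ∞)`
  (`antitoneOn_of_hasDerivWithinAt_nonpos`); take `μ = 1/t` and use `1 − e^{−x} ≤ x` — the price of avoiding `√` is exactly the factor `e`.
* `twoRateKernel_mul_le_form_exp` — pointwise: `(e^{−hi t} − √e(τhi/2)·t·e^{−lo t})|v|² ≤ vᵀe^{−tB}v` (symmetric Loewner pinch for `H`,
  `Literature…le_dotProduct_exp_neg_smul_mulVec`, + Cauchy–Schwarz on `vᵀw`).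
* `kernel_mul_le_sum_sum_mul_qsResp_mul` — the kernel integration of p643071 for a general continuous scalar minorant; `kernel_twoRate_eq` —
  `T∫∫aa(e^{−T(s−x)hi} − cT(s−x)e^{−T(s−x)lo}) = f_T(hi) − c·g_T(lo)`.
* **`lowerEdgeTargetE_holds : LowerEdgeTargetE ρ`** — `∀ T ≥ 0, ∀ B` (sector `τ ≥ 0`, window `[lo, hi]`, `0 < lo`), `∀ v`:
  `(f_T(hi) − √e·(τhi/2)·g_T(lo))·|v|² ≤ vᵀ f_T(B) v`; `window_clause_sectorial` = the slot window clause, now UNCONDITIONAL, in the currency of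
  `oddSectorial_excQS_strict_of_slotWindows` (§4): `ylo = f_T(hi) − √e(τhi/2)g_T(lo)`, `yhi = f_T(lo)` (times the slot mass).
  DESIGN (profile j313542 re-read with the constant `√e`; `κ = (√5/3)·max yhi/min ylo`): `ΛV = 1.05`: `κ ≤ 0.894 / 0.873 / 0.866 / 0.866`
  (`M = 0.01 / 0.02 / 0.05 / 0.1`) at `τ₀ = 0.05`, `≤ 0.938 / 0.920 / 0.914 / 0.914` at `τ₀ = 0.1`, OUT (`κ > 1`) at `τ₀ = 0.2`;
  `ΛV = 1.10`: `τ₀ = 0.05` only (`κ ≤ 0.986 / 0.967 / 0.961 / 0.960`); `ΛV = 1.15`: out.  The typed targets `LowerEdgeTarget` (constant `1`: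
  `τ₀ ≤ 0.2` at `ΛV = 1.05`) and `LowerEdgeTargetSharp` (loss `τ²/4`: `τ₀ ≤ 0.3`) remain as the two upgrades; the measured truth is the sharp one.
§7 (v4, PROVED, sorry-free) — THE CONSTANT UPGRADE `√e → 1`, i.e. **`lowerEdgeTarget_holds : LowerEdgeTarget ρ`** (the typed target of §5 exactly):
* `duhamel_defect_sq_le_one` — `|w(t)|² ≤ (τhi/2)²t²e^{−2lo t}|v|²`: the sharp differential inequality `|w|²' ≤ −2lo|w|² + 2|w|·(τhi/2)e^{−lo s}|v|`
  (Cauchy–Schwarz with square roots, `Real.sum_mul_le_sqrt_mul_sqrt`) and the `√`-regularised Lyapunov function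
  `Φ_ε(s) = e^{lo s}√(|w(s)|² + ε²) − (τhi/2)|v|·s − ε·e^{lo s}`, non-increasing on `[0, ∞)` for every `ε > 0` (`HasDerivAt.sqrt` away from `0`);
  `Φ_ε(t) ≤ Φ_ε(0) = 0` gives `e^{lo t}|w(t)| ≤ (τhi/2)|v|t + εe^{lo t}`, and `ε → 0` (`le_of_forall_pos_le_add`).
* `twoRateKernel_mul_le_form_exp_one`, `lowerEdgeTarget_holds`, `window_clause_sectorial_one` (= `window_clause_of_lowerEdgeTarget` discharged).
  DESIGN with constant `1` (j313542 re-read): `ΛV = 1.05`: `τ₀ ≤ 0.2 ⇒ κ ≤ 0.959 / 0.942 / 0.937 / 0.936` (`M = 0.01 / 0.02 / 0.05 / 0.1`), `τ₀ = 0.1 ⇒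
  κ ≤ 0.902 / 0.882 / 0.876 / 0.875`, `τ₀ = 0.3` marginally out (`1.02 / 1.009 / 1.006 / 1.005`); `ΛV = 1.10`: `τ₀ ≤ 0.1 ⇒ κ ≤ 0.998 / 0.980 / 0.974 / 0.974`.
  Only `LowerEdgeTargetSharp` (loss `τ²/4`, the measured truth) remains typed-not-proved; it would admit `τ₀ ≤ 0.3` and `ΛV = 1.10` comfortably.
§8 (v5, PROVED, sorry-free) — A LOSSY, PROVED SUBSTITUTE FOR L1⁺ (sector preservation by the slot response):
* `skewForm_exp_le` — `xᵀe^{−uB}z − zᵀe^{−uB}x ≤ τ·hi·u·e^{−lo u}(|x|² + |z|²)/2` (`e^{−uH}` is symmetric, `Matrix.IsSymm.exp`; the defect has operator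
  norm `≤ (τhi/2)u e^{−lo u}` by `duhamel_defect_sq_le_one`); `sum_sum_mul_qsResp_coeff(_le)` — p643071's kernel identity / monotone integration for a
  general linear functional `Σ cᵢⱼ Mᵢⱼ` of the kernel (the skew form has `cᵢⱼ = xᵢzⱼ − zᵢxⱼ`); `skewForm_qsResp_le` — `xᵀFz − zᵀFx ≤ τ·hi·g_T(lo)(|x|²+|z|²)/2`;
* **`qsResp_sector_lossy` / `lossySectorTarget_holds : LossySectorTarget ρ`** — for `F = f_T(B)`, `ylo = f_T(hi) − (τhi/2)g_T(lo) > 0`: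
  `(xᵀFz − zᵀFx)² ≤ (τθ)²·(xᵀFx)(zᵀFz)`, `θ = hi·g_T(lo)/ylo` (scaling `x ↦ cx` + discriminant turn AM–GM into the product form; the lower window §7
  converts `|x|²|z|²` into the forms).  Static limit `θ → ΛV⁴/(1 − τΛV⁴/2)` — LOSSY (the measured truth is `θ ≤ 1`, j313805), but enough at NARROW windows:
  `κ = γ(c)·θ` (local exact quadrature of `f_T, g_T`, tent `ρ = 1/2`, `T_s = 1579·M·{1, 6.4, 18.2}`): `ΛV = 1.02`: `τ₀ = 0.05 ⇒ κ = 0.919 / 0.895 / 0.888`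
  (`M = 0.01 / 0.02 / 0.05`), `τ₀ = 0.1 ⇒ 0.970 / 0.947 / 0.940`; `ΛV = 1.03`: `τ₀ = 0.05 ⇒ 0.976 / 0.951 / 0.944`, `τ₀ = 0.1` out; `ΛV = 1.05` out (`≥ 1.04`).
  So IF tenure can take the window `ΛV ∈ [1.02, 1.03]` (M ≥ 0.02, τ₀ ≤ 0.05–0.1), the odd half of W5 needs NO unproved analytic hypothesis at all
  (§1–§4 + §5 upper edge + §7 lower edge + §8 lossy sector); at `ΛV = 1.05` it needs L1⁺ (measured `θ ≤ 1`).
§9 (v6, answer to tenure D24-16's ASK «certified finite-T sector non-expansion vs the resolvent theorem?») — THE EXACT ROUTE IS NOT XL: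
* `sector_resolventAtom` (PROVED, the "atom lemma", five lines of algebra): if `C` is coercive and `τ`-sectorial then every resolvent atom
  `R_s = C(C² + s)⁻¹` (`s ≥ 0`; `= Re_ℂ(C + i√s)⁻¹ = ∫₀^∞cos(√s u)e^{−uC}du`) is `τ`-sectorial and accretive — substitute `x = (C²+s)p`, `z = (C²+s)q`:
  `xᵀRz = vᵀCu + s·pᵀCq` (`u = Cp`, `v = Cq`), and the two sector inequalities at `(u,v)`, `(p,q)` add up (`sq_add_le_of_sq_le`; complex form:
  `⟨Rw,w⟩ = conj⟨Cu,u⟩ + s⟨Cp,p⟩ ∈ S_θ`).  `isUnit_det_sq_add`: `C² + s` is invertible for coercive `C`.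
* `CosineMixture ρ` (TYPED, the single analytic input, NOT proved here per D24-16 «memo first»): for `0 < ρ ≤ 1/2`, `T > 0`, coercive `B`:
  `xᵀf_T(B)z = (T/π)∫₀^∞ Â_ρ(ξ)·xᵀ[(TB)((TB)²+ξ²)⁻¹]z dξ` with `Â_ρ(ξ) = 16 sin²(ρξ/2)sin²((1−ρ)ξ/2)/(ρ²ξ⁴) = |â(ξ)|² ≥ 0` (`slotSpec`; the slot
  kernel `A = a⋆ã` is the autocorrelation of the trapezoid `a = ρ⁻¹𝟙_{[0,ρ]}⋆𝟙_{[0,1−ρ]}` — Wiener–Khinchin/Bochner; verified numerically to 10⁻⁶,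
  `odd9/cosine_repr_check.py`).  Lean route: Fubini + `∫₀^∞cos(ξu)e^{−uC}du = C(C²+ξ²)⁻¹` (FTC on `Ioi`) + Mathlib `Continuous.fourier_inversion`
  for the compactly supported `C²` spline `A` (`𝓕A = |â|²` by Fubini, `= O(ξ⁻⁴)` integrable).  Size: M–L (one file), not XL.
* **`sectorPreservation_of_cosineMixture` (PROVED)**: `CosineMixture ρ →` for `T > 0` and every coercive `τ`-sectorial `B`, `f_T(B)` is `τ`-sectorial —
  EXACT non-expansion `θ ≤ 1` = hypothesis L1⁺ = branch B of D24-16 (`ΛV` up to 1.10), from: atoms sector-safe, weights `Â_ρ ≥ 0`, monotone set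
  integral, and the scaling/discriminant trick (`sq_le_of_forall_scale`).
  VERDICT for tenure: a finite-T NUMERICAL certificate is the WRONG tool — exact non-expansion has slack `1 − θ(T) ≈ 17/T² → 0` (5·10⁻⁵ at the
  largest slot time), so certifying `θ ≤ 1` is impossible and certifying the sufficient `θ ≤ 1/γ(c) ≈ 1.12` (`ΛV = 1.05`) is a 6-parameter
  branch-and-bound over (T, window shape, rotation) with certified matrix-exponential quadrature — days, and weaker than the theorem; the exact theorem
  costs ONE standard Fourier-analytic identity (above) and nothing else.
No named facts, no sorry.  NOT a proof of the stub, of the crux, of Onsager's conjecture or of anomalous dissipation — rung-leaf F-D1.A0 algebra.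
LANDING NOTE: ≈ 1480 lines — further split at `section SectorAtoms` (`…CellLawVOddGainSectorAtoms.lean`); ≈ 1150 lines — one more split at `section LossySector` (`…CellLawVOddGainDefectLossySector.lean`); earlier: ≈ 830 lines — split at `section LowerEdge` / `section LowerEdgeSharpConstant` into `…CellLawVOddGainDefectSectorialWindow.lean` (§5),
`…CellLawVOddGainDefectLowerEdge.lean` (§6) and `…CellLawVOddGainDefectLowerEdgeOne.lean` (§7); §6 may be dropped entirely if only the constant-1 form is wanted
(§7 uses from §6 only `symPart/skewPart` + their four lemmas, `window_symPart_sum`, `skewPart_sq_le`, `lo_le_hi_of_window`, `twoRateKernel`, `continuous_twoRateKernel`,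
`kernel_mul_le_sum_sum_mul_qsResp_mul`, `kernel_twoRate_eq`).
-/

set_option linter.dupNamespace false

noncomputable section

namespace Summit.AnomalousDissipation.AnomalousDissipation.Theorems.SolenoidalFractalHomogenisation.LagrangianStep.OddGain

open Matrix Finset

section Sectorial

open Literature.Analysis Literature.Analysis.FunctionSpaces Literature.Analysis.FluidPDE
open Literature.Analysis.FluidPDE.LatticeShear

/-- `x·x = Σ xᵢ²` (local copy; `…OddGainDefectWindows` has the same fact as `dotProduct_self_eq_sum_sq`). -/
theorem self_dotProduct_eq_sum_sq (x : Fin 3 → ℝ) : x ⬝ᵥ x = ∑ i, x i ^ 2 := by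
  simp [dotProduct, sq]

/-- **Contractivity ⇒ upper semigroup bound for the quadratic form, NO symmetry**: `lo|x|² ≤ xᵀBx` for all `x` gives
`vᵀe^{−tB}v ≤ e^{−lo t}|v|²` (`t ≥ 0`): `|e^{−tB}v| ≤ e^{−lo t}|v|` (p642614, invariant hyperplane `u = 0`) and Cauchy–Schwarz. [folklore] -/
theorem form_exp_le_of_coercive {B : Matrix (Fin 3) (Fin 3) ℝ} {lo : ℝ} (hwin : ∀ x : Fin 3 → ℝ, lo * (x ⬝ᵥ x) ≤ x ⬝ᵥ B *ᵥ x)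
    (v : Fin 3 → ℝ) {t : ℝ} (ht : 0 ≤ t) :
    ∑ i, v i * (NormedSpace.exp (-(t • B))).mulVec v i ≤ Real.exp (-(lo * t)) * ∑ i, v i ^ 2 := by
  have hu : ∀ j, ∑ i, (0 : Fin 3 → ℝ) i * B i j = 0 * (0 : Fin 3 → ℝ) j := by intro j; simp
  have hlo : ∀ w : Fin 3 → ℝ, ∑ i, (0 : Fin 3 → ℝ) i * w i = 0 → lo * ∑ i, w i ^ 2 ≤ ∑ i, ∑ j, w i * B i j * w j := by
    intro w _; rw [sum_sum_eq_form, ← self_dotProduct_eq_sum_sq]; exact hwin w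
  have hv : ∑ i, (0 : Fin 3 → ℝ) i * v i = 0 := by simp
  set z := (NormedSpace.exp (-(t • B))).mulVec v with hz
  have hcontr : ∑ i, z i ^ 2 ≤ Real.exp (-(2 * lo * t)) * ∑ i, v i ^ 2 :=
    sum_sq_exp_neg_smul_mulVec_le_of_perp B hu hlo hv ht
  have hv0 : 0 ≤ ∑ i, v i ^ 2 := Finset.sum_nonneg fun i _ => sq_nonneg _
  have hcs : (∑ i, v i * z i) ^ 2 ≤ (∑ i, v i ^ 2) * ∑ i, z i ^ 2 := Finset.sum_mul_sq_le_sq_mul_sq _ _ _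
  have hsq : (∑ i, v i * z i) ^ 2 ≤ (Real.exp (-(lo * t)) * ∑ i, v i ^ 2) ^ 2 := by
    have hexp : Real.exp (-(2 * lo * t)) = Real.exp (-(lo * t)) ^ 2 := by
      rw [sq, ← Real.exp_add]; ring_nf
    calc (∑ i, v i * z i) ^ 2 ≤ (∑ i, v i ^ 2) * ∑ i, z i ^ 2 := hcs
      _ ≤ (∑ i, v i ^ 2) * (Real.exp (-(2 * lo * t)) * ∑ i, v i ^ 2) := mul_le_mul_of_nonneg_left hcontr hv0
      _ = (Real.exp (-(lo * t)) * ∑ i, v i ^ 2) ^ 2 := by rw [hexp]; ring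
  have hnn : 0 ≤ Real.exp (-(lo * t)) * ∑ i, v i ^ 2 := mul_nonneg (Real.exp_pos _).le hv0
  exact (abs_le.mp (abs_le_of_sq_le_sq hsq hnn)).2

/-- **THE UPPER WINDOW EDGE FOR SECTORIAL BLOCKS, no loss**: `lo|x|² ≤ xᵀBx` for all `x` and `T ≥ 0` give `vᵀ f_T(B) v ≤ f_T(lo)|v|²`
(`f_T = qsRespScalar ρ T`) for EVERY (not necessarily symmetric) block — the upper half of the window clause of
`oddSectorial_excQS_strict_of_slot` costs nothing in `τ`. [folklore] -/
theorem qsResp_window_upper {ρ T lo : ℝ} (hT : 0 ≤ T) {B : Matrix (Fin 3) (Fin 3) ℝ}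
    (hwin : ∀ x : Fin 3 → ℝ, lo * (x ⬝ᵥ x) ≤ x ⬝ᵥ B *ᵥ x) (v : Fin 3 → ℝ) :
    v ⬝ᵥ (qsResp ρ T B) *ᵥ v ≤ qsRespScalar ρ T lo * (v ⬝ᵥ v) := by
  have upp := sum_sum_mul_qsResp_mul_le (ρ := ρ) hT (fun t ht => form_exp_le_of_coercive hwin v ht)
  rw [sum_sum_eq_form, ← self_dotProduct_eq_sum_sq] at upp
  exact upp

/-- … on `P_s`-projected vectors, in the `perpSq` currency: `(P_s x)ᵀ f_T(B) (P_s x) ≤ f_T(lo)|P_s x|²`. [folklore] -/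
theorem qsResp_window_upper_projPerp {ρ T lo : ℝ} (hT : 0 ≤ T) {B : Matrix (Fin 3) (Fin 3) ℝ}
    (hwin : ∀ x : Fin 3 → ℝ, lo * (x ⬝ᵥ x) ≤ x ⬝ᵥ B *ᵥ x) (s : Fin 26) (x : Fin 3 → ℝ) :
    ((projPerp (slotN s)) *ᵥ x) ⬝ᵥ (qsResp ρ T B) *ᵥ ((projPerp (slotN s)) *ᵥ x) ≤ qsRespScalar ρ T lo * perpSq (slotN s) x := by
  have hn : ∑ a, slotN s a ^ 2 = 1 := by rw [← self_dotProduct_eq_sum_sq]; exact slotN_unit s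
  rw [← perpSq_eq_projPerp (slotN s) x hn]
  exact qsResp_window_upper hT hwin _

/-- `zᵀBx = xᵀBᵀz`. -/
theorem form_comm_transpose (B : Matrix (Fin 3) (Fin 3) ℝ) (x z : Fin 3 → ℝ) : z ⬝ᵥ B *ᵥ x = x ⬝ᵥ Bᵀ *ᵥ z := by
  rw [Matrix.mulVec_transpose, Matrix.dotProduct_mulVec, dotProduct_comm]

/-- **The sector hypothesis bounds the skew part**: `(xᵀBz − zᵀBx)² ≤ τ²·xᵀBx·zᵀBz` (all `x, z`) and the window `lo|x|² ≤ xᵀBx ≤ hi|x|²`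
(`lo ≥ 0`) give `|(B − Bᵀ)z|² ≤ (τ·hi)²·|z|²`, i.e. `‖K‖ ≤ τ·hi/2` for `K = (B − Bᵀ)/2` (test the sector inequality at `x = (B − Bᵀ)z`). [folklore] -/
theorem skew_sq_le_of_sector {B : Matrix (Fin 3) (Fin 3) ℝ} {τ lo hi : ℝ} (hlo : 0 ≤ lo)
    (hsec : ∀ x z : Fin 3 → ℝ, (x ⬝ᵥ B *ᵥ z - z ⬝ᵥ B *ᵥ x) ^ 2 ≤ τ ^ 2 * ((x ⬝ᵥ B *ᵥ x) * (z ⬝ᵥ B *ᵥ z)))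
    (hwin : ∀ x : Fin 3 → ℝ, lo * (x ⬝ᵥ x) ≤ x ⬝ᵥ B *ᵥ x ∧ x ⬝ᵥ B *ᵥ x ≤ hi * (x ⬝ᵥ x)) (z : Fin 3 → ℝ) :
    (B *ᵥ z - Bᵀ *ᵥ z) ⬝ᵥ (B *ᵥ z - Bᵀ *ᵥ z) ≤ (τ * hi) ^ 2 * (z ⬝ᵥ z) := by
  set w := B *ᵥ z - Bᵀ *ᵥ z with hw
  have hkey : w ⬝ᵥ B *ᵥ z - z ⬝ᵥ B *ᵥ w = w ⬝ᵥ w := by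
    rw [form_comm_transpose B w z, hw, dotProduct_sub]
  have h1 := hsec w z
  rw [hkey] at h1
  have hnn : ∀ x : Fin 3 → ℝ, 0 ≤ x ⬝ᵥ x := fun x => by
    rw [self_dotProduct_eq_sum_sq]; exact Finset.sum_nonneg fun i _ => sq_nonneg _
  have hw0 := hnn w
  have hz0 := hnn z
  have hBw0 : 0 ≤ w ⬝ᵥ B *ᵥ w := (mul_nonneg hlo hw0).trans (hwin w).1
  have hBz0 : 0 ≤ z ⬝ᵥ B *ᵥ z := (mul_nonneg hlo hz0).trans (hwin z).1
  have hhi0 : 0 ≤ hi * (w ⬝ᵥ w) := hBw0.trans (hwin w).2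
  have hprod : (w ⬝ᵥ B *ᵥ w) * (z ⬝ᵥ B *ᵥ z) ≤ (hi * (w ⬝ᵥ w)) * (hi * (z ⬝ᵥ z)) :=
    mul_le_mul (hwin w).2 (hwin z).2 hBz0 hhi0
  have h2 : (w ⬝ᵥ w) ^ 2 ≤ ((τ * hi) ^ 2 * (z ⬝ᵥ z)) * (w ⬝ᵥ w) := by
    calc (w ⬝ᵥ w) ^ 2 ≤ τ ^ 2 * ((w ⬝ᵥ B *ᵥ w) * (z ⬝ᵥ B *ᵥ z)) := h1
      _ ≤ τ ^ 2 * ((hi * (w ⬝ᵥ w)) * (hi * (z ⬝ᵥ z))) := mul_le_mul_of_nonneg_left hprod (sq_nonneg _)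
      _ = ((τ * hi) ^ 2 * (z ⬝ᵥ z)) * (w ⬝ᵥ w) := by ring
  rcases hw0.lt_or_eq with hpos | hzero
  · rw [sq] at h2
    exact le_of_mul_le_mul_right h2 hpos
  · rw [← hzero]
    exact mul_nonneg (sq_nonneg _) hz0

/-! ### The typed lower-edge target (statement only; first order in `τ`) -/

/-- The kernel-weighted first moment `g_T(a) = T ∫₀¹ a(s) ∫₀ˢ a(x) · T(s−x) · e^{−T(s−x)a} dx ds` (`= −∂_a f_T(a)`; for `T a ≫ 1`, `g_T(a) → ϑ_∞/a²`). -/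
def qsRespMoment (ρ T a : ℝ) : ℝ :=
  T * ∫ s in (0:ℝ)..1, LatticeShear.LatticeWord.trapezoid 0 1 ρ s *
    ∫ x in (0:ℝ)..s, LatticeShear.LatticeWord.trapezoid 0 1 ρ x * ((T * (s - x)) * Real.exp (-(T * (s - x)) * a))

/-- **TYPED TARGET (not proved here): the LOWER window edge for sectorial blocks, first order in `τ`.**  For `T ≥ 0`, a block `B` in the
Kato sector `τ` with window `[lo, hi]` (`0 < lo`), and every `v`: `vᵀ f_T(B) v ≥ (f_T(hi) − (τ·hi/2)·g_T(lo))·|v|²`.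
Route: `H = (B + Bᵀ)/2` is symmetric with the same window; `w(t) = e^{−tB}v − e^{−tH}v` solves `w' = −Bw − K e^{−tH}v` (`K = (B − Bᵀ)/2`,
`|Kx| ≤ (τhi/2)|x|` by `skew_sq_le_of_sector`), so `d/dt(e^{lo t}|w|) ≤ (τhi/2)|v|` and `|w(t)| ≤ (τhi/2)·t·e^{−lo t}|v|`; then
`vᵀe^{−tB}v ≥ vᵀe^{−tH}v − |v||w(t)| ≥ (e^{−hi t} − (τhi/2) t e^{−lo t})|v|²` (symmetric pinch p642614 on `H`) and the kernel integration of
p643071 (a two-rate variant of `le_sum_sum_mul_qsResp_mul`).  With `g_T(lo) ≤ ϑ_∞/lo²` and `f_T(hi) ≈ ϑ_∞/hi` the relative loss of the lower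
edge is `τ·hi²/(2lo²)` — the design number of the memo.  (The true loss is `O(τ²)`.) -/
def LowerEdgeTarget (ρ : ℝ) : Prop :=
  ∀ T : ℝ, 0 ≤ T → ∀ (B : Matrix (Fin 3) (Fin 3) ℝ) (τ lo hi : ℝ), 0 ≤ τ → 0 < lo →
    (∀ x z : Fin 3 → ℝ, (x ⬝ᵥ B *ᵥ z - z ⬝ᵥ B *ᵥ x) ^ 2 ≤ τ ^ 2 * ((x ⬝ᵥ B *ᵥ x) * (z ⬝ᵥ B *ᵥ z))) →
    (∀ x : Fin 3 → ℝ, lo * (x ⬝ᵥ x) ≤ x ⬝ᵥ B *ᵥ x ∧ x ⬝ᵥ B *ᵥ x ≤ hi * (x ⬝ᵥ x)) →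
    ∀ v : Fin 3 → ℝ, (qsRespScalar ρ T hi - τ * hi / 2 * qsRespMoment ρ T lo) * (v ⬝ᵥ v) ≤ v ⬝ᵥ (qsResp ρ T B) *ᵥ v

/-- **How the target closes the window clause** (bookkeeping, proved): `LowerEdgeTarget` + `qsResp_window_upper` give, for every sectorial block
of slot `s`, the transverse window `[f_T(hi) − (τhi/2) g_T(lo), f_T(lo)]·|P_s x|²` — the extra clause of `oddSectorial_excQS_strict_of_slot`
in the slot-dependent form consumed by `oddSectorial_excQS_strict_of_slotWindows`. [folklore] -/
theorem window_clause_of_lowerEdgeTarget {ρ : ℝ} (hLE : LowerEdgeTarget ρ) {T : ℝ} (hT : 0 ≤ T) {B : Matrix (Fin 3) (Fin 3) ℝ}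
    {τ lo hi : ℝ} (hτ : 0 ≤ τ) (hlo : 0 < lo)
    (hsec : ∀ x z : Fin 3 → ℝ, (x ⬝ᵥ B *ᵥ z - z ⬝ᵥ B *ᵥ x) ^ 2 ≤ τ ^ 2 * ((x ⬝ᵥ B *ᵥ x) * (z ⬝ᵥ B *ᵥ z)))
    (hwin : ∀ x : Fin 3 → ℝ, lo * (x ⬝ᵥ x) ≤ x ⬝ᵥ B *ᵥ x ∧ x ⬝ᵥ B *ᵥ x ≤ hi * (x ⬝ᵥ x)) (s : Fin 26) (x : Fin 3 → ℝ) :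
    (qsRespScalar ρ T hi - τ * hi / 2 * qsRespMoment ρ T lo) * perpSq (slotN s) x ≤
      ((projPerp (slotN s)) *ᵥ x) ⬝ᵥ (qsResp ρ T B) *ᵥ ((projPerp (slotN s)) *ᵥ x) ∧
    ((projPerp (slotN s)) *ᵥ x) ⬝ᵥ (qsResp ρ T B) *ᵥ ((projPerp (slotN s)) *ᵥ x) ≤ qsRespScalar ρ T lo * perpSq (slotN s) x := by
  have hn : ∑ a, slotN s a ^ 2 = 1 := by rw [← self_dotProduct_eq_sum_sq]; exact slotN_unit s
  refine ⟨?_, qsResp_window_upper_projPerp hT (fun x => (hwin x).1) s x⟩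
  rw [← perpSq_eq_projPerp (slotN s) x hn]
  exact hLE T hT B τ lo hi hτ hlo hsec hwin _

/-- **TYPED TARGET, SHARP FORM (not proved here; constant from the profile j313542 and the static limit):** for `T ≥ 0`, a block `B` in the
Kato sector `τ` with window `[lo, hi]` (`0 < lo`), and every `v`: `vᵀ f_T(B) v ≥ f_T(hi)/(1 + τ²/4)·|v|²`.  Numerically attained as `T → ∞` by
`B = hi·(𝟙 + (τ/2)[u]_×)`; for finite `T` the measured loss is smaller (`0.21τ²` at `T = 16`).  Static-limit mechanism: for `A` skew with
`‖A‖ ≤ τ/2`, `sym((𝟙 + A)⁻¹) = (𝟙 − A²)⁻¹ ≥ 𝟙/(1 + τ²/4)`. -/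
def LowerEdgeTargetSharp (ρ : ℝ) : Prop :=
  ∀ T : ℝ, 0 ≤ T → ∀ (B : Matrix (Fin 3) (Fin 3) ℝ) (τ lo hi : ℝ), 0 ≤ τ → 0 < lo →
    (∀ x z : Fin 3 → ℝ, (x ⬝ᵥ B *ᵥ z - z ⬝ᵥ B *ᵥ x) ^ 2 ≤ τ ^ 2 * ((x ⬝ᵥ B *ᵥ x) * (z ⬝ᵥ B *ᵥ z))) →
    (∀ x : Fin 3 → ℝ, lo * (x ⬝ᵥ x) ≤ x ⬝ᵥ B *ᵥ x ∧ x ⬝ᵥ B *ᵥ x ≤ hi * (x ⬝ᵥ x)) →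
    ∀ v : Fin 3 → ℝ, qsRespScalar ρ T hi / (1 + τ ^ 2 / 4) * (v ⬝ᵥ v) ≤ v ⬝ᵥ (qsResp ρ T B) *ᵥ v

/-- **How the sharp target closes the window clause** (bookkeeping, proved): the slot window `[f_T(hi)/(1 + τ²/4), f_T(lo)]·|P_s x|²`, i.e. the
box ratio of `oddSectorial_excQS_strict_of_slotWindows` is the symmetric one times `(1 + τ²/4)`. [folklore] -/
theorem window_clause_of_lowerEdgeTargetSharp {ρ : ℝ} (hLE : LowerEdgeTargetSharp ρ) {T : ℝ} (hT : 0 ≤ T) {B : Matrix (Fin 3) (Fin 3) ℝ}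
    {τ lo hi : ℝ} (hτ : 0 ≤ τ) (hlo : 0 < lo)
    (hsec : ∀ x z : Fin 3 → ℝ, (x ⬝ᵥ B *ᵥ z - z ⬝ᵥ B *ᵥ x) ^ 2 ≤ τ ^ 2 * ((x ⬝ᵥ B *ᵥ x) * (z ⬝ᵥ B *ᵥ z)))
    (hwin : ∀ x : Fin 3 → ℝ, lo * (x ⬝ᵥ x) ≤ x ⬝ᵥ B *ᵥ x ∧ x ⬝ᵥ B *ᵥ x ≤ hi * (x ⬝ᵥ x)) (s : Fin 26) (x : Fin 3 → ℝ) :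
    qsRespScalar ρ T hi / (1 + τ ^ 2 / 4) * perpSq (slotN s) x ≤
      ((projPerp (slotN s)) *ᵥ x) ⬝ᵥ (qsResp ρ T B) *ᵥ ((projPerp (slotN s)) *ᵥ x) ∧
    ((projPerp (slotN s)) *ᵥ x) ⬝ᵥ (qsResp ρ T B) *ᵥ ((projPerp (slotN s)) *ᵥ x) ≤ qsRespScalar ρ T lo * perpSq (slotN s) x := by
  have hn : ∑ a, slotN s a ^ 2 = 1 := by rw [← self_dotProduct_eq_sum_sq]; exact slotN_unit s
  refine ⟨?_, qsResp_window_upper_projPerp hT (fun x => (hwin x).1) s x⟩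
  rw [← perpSq_eq_projPerp (slotN s) x hn]
  exact hLE T hT B τ lo hi hτ hlo hsec hwin _

end Sectorial


/-! ## §6 THE LOWER WINDOW EDGE FOR SECTORIAL BLOCKS, first order in `τ` — PROVED with the constant `√e·τhi/2`
(energy estimate for the Duhamel defect `w(t) = e^{−tB}v − e^{−tH}v`, `H = (B + Bᵀ)/2`; no square roots are differentiated:
`Ψ(s) = e^{(2lo−μ)s}|w(s)|² + (τhi/2)²|v|²e^{−μs}/μ²` is non-increasing, then `μ = 1/t`) -/

section LowerEdge

open Literature.Analysis Literature.Analysis.FunctionSpaces Literature.Analysis.FluidPDE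
open Literature.Analysis.FluidPDE.LatticeShear
open Literature.Analysis.ODE.PeriodicAveraging

/-- The symmetric part `H = (B + Bᵀ)/2`. -/
def symPart (B : Matrix (Fin 3) (Fin 3) ℝ) : Matrix (Fin 3) (Fin 3) ℝ := (1 / 2 : ℝ) • (B + Bᵀ)

/-- The skew part `K = (B − Bᵀ)/2`. -/
def skewPart (B : Matrix (Fin 3) (Fin 3) ℝ) : Matrix (Fin 3) (Fin 3) ℝ := (1 / 2 : ℝ) • (B - Bᵀ)

theorem symPart_isSymm (B : Matrix (Fin 3) (Fin 3) ℝ) : (symPart B).IsSymm := by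
  unfold symPart Matrix.IsSymm
  rw [Matrix.transpose_smul, Matrix.transpose_add, Matrix.transpose_transpose, add_comm]

theorem symPart_add_skewPart (B : Matrix (Fin 3) (Fin 3) ℝ) : symPart B + skewPart B = B := by
  ext i j
  simp only [symPart, skewPart, Matrix.add_apply, Matrix.smul_apply, Matrix.sub_apply, Matrix.transpose_apply,
    smul_eq_mul]
  ring

/-- `xᵀHx = xᵀBx`. -/
theorem form_symPart (B : Matrix (Fin 3) (Fin 3) ℝ) (x : Fin 3 → ℝ) : x ⬝ᵥ (symPart B) *ᵥ x = x ⬝ᵥ B *ᵥ x := by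
  unfold symPart
  rw [Matrix.smul_mulVec, dotProduct_smul, Matrix.add_mulVec, dotProduct_add, ← form_comm_transpose B x x,
    smul_eq_mul]
  ring

/-- `K y = ½ (B y − Bᵀ y)`. -/
theorem skewPart_mulVec (B : Matrix (Fin 3) (Fin 3) ℝ) (y : Fin 3 → ℝ) :
    (skewPart B) *ᵥ y = (1 / 2 : ℝ) • (B *ᵥ y - Bᵀ *ᵥ y) := by
  unfold skewPart
  rw [Matrix.smul_mulVec, Matrix.sub_mulVec]

/-- `ΣΣ`-form of the window of `H` (the shape the Literature semigroup lemmas want). -/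
theorem window_symPart_sum {B : Matrix (Fin 3) (Fin 3) ℝ} {lo hi : ℝ}
    (hwin : ∀ x : Fin 3 → ℝ, lo * (x ⬝ᵥ x) ≤ x ⬝ᵥ B *ᵥ x ∧ x ⬝ᵥ B *ᵥ x ≤ hi * (x ⬝ᵥ x)) (x : Fin 3 → ℝ) :
    lo * ∑ i, x i ^ 2 ≤ ∑ i, ∑ j, x i * symPart B i j * x j ∧ ∑ i, ∑ j, x i * symPart B i j * x j ≤ hi * ∑ i, x i ^ 2 := by
  rw [sum_sum_eq_form, form_symPart, ← self_dotProduct_eq_sum_sq]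
  exact hwin x

/-- The skew part is small: `Σ (K y)ᵢ² ≤ (τhi/2)² Σ yᵢ²`. -/
theorem skewPart_sq_le {B : Matrix (Fin 3) (Fin 3) ℝ} {τ lo hi : ℝ} (hlo : 0 ≤ lo)
    (hsec : ∀ x z : Fin 3 → ℝ, (x ⬝ᵥ B *ᵥ z - z ⬝ᵥ B *ᵥ x) ^ 2 ≤ τ ^ 2 * ((x ⬝ᵥ B *ᵥ x) * (z ⬝ᵥ B *ᵥ z)))
    (hwin : ∀ x : Fin 3 → ℝ, lo * (x ⬝ᵥ x) ≤ x ⬝ᵥ B *ᵥ x ∧ x ⬝ᵥ B *ᵥ x ≤ hi * (x ⬝ᵥ x)) (y : Fin 3 → ℝ) :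
    ∑ i, ((skewPart B) *ᵥ y) i ^ 2 ≤ (τ * hi / 2) ^ 2 * ∑ i, y i ^ 2 := by
  have h := skew_sq_le_of_sector hlo hsec hwin y
  rw [self_dotProduct_eq_sum_sq, self_dotProduct_eq_sum_sq] at h
  rw [skewPart_mulVec]
  have h4 : ∑ i, ((1 / 2 : ℝ) • (B *ᵥ y - Bᵀ *ᵥ y)) i ^ 2 = (1 / 4) * ∑ i, (B *ᵥ y - Bᵀ *ᵥ y) i ^ 2 := by
    rw [Finset.mul_sum]
    refine Finset.sum_congr rfl fun i _ => ?_
    simp only [Pi.smul_apply, smul_eq_mul]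
    ring
  rw [h4]
  nlinarith [h]

/-- From the window: `lo ≤ hi`. -/
theorem lo_le_hi_of_window {B : Matrix (Fin 3) (Fin 3) ℝ} {lo hi : ℝ}
    (hwin : ∀ x : Fin 3 → ℝ, lo * (x ⬝ᵥ x) ≤ x ⬝ᵥ B *ᵥ x ∧ x ⬝ᵥ B *ᵥ x ≤ hi * (x ⬝ᵥ x)) : lo ≤ hi := by
  have h := hwin (Pi.single 0 1)
  have h1 : (Pi.single (0 : Fin 3) (1 : ℝ)) ⬝ᵥ (Pi.single 0 1) = 1 := by simp
  rw [h1, mul_one, mul_one] at h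
  exact h.1.trans h.2

/-- **The energy estimate for the Duhamel defect** `w(t) = e^{−tB}v − e^{−tH}v` (`H` the symmetric part):
`Σ wᵢ(t)² ≤ e · (τhi/2)² · t² · e^{−2lo t} · Σ vᵢ²` for `t ≥ 0`.  Proof: `|w|²' = −2wᵀBw − 2wᵀK e^{−tH}v ≤ (μ − 2lo)|w|² + (τhi/2)²e^{−2lo t}|v|²/μ`,
so `e^{(2lo−μ)s}|w|² + (τhi/2)²|v|²e^{−μs}/μ²` is non-increasing; `μ = 1/t`. [folklore] -/
theorem duhamel_defect_sq_le {B : Matrix (Fin 3) (Fin 3) ℝ} {τ lo hi : ℝ} (hlo : 0 ≤ lo)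
    (hsec : ∀ x z : Fin 3 → ℝ, (x ⬝ᵥ B *ᵥ z - z ⬝ᵥ B *ᵥ x) ^ 2 ≤ τ ^ 2 * ((x ⬝ᵥ B *ᵥ x) * (z ⬝ᵥ B *ᵥ z)))
    (hwin : ∀ x : Fin 3 → ℝ, lo * (x ⬝ᵥ x) ≤ x ⬝ᵥ B *ᵥ x ∧ x ⬝ᵥ B *ᵥ x ≤ hi * (x ⬝ᵥ x)) (v : Fin 3 → ℝ) {t : ℝ} (ht : 0 ≤ t) :
    ∑ i, ((NormedSpace.exp (-(t • B))).mulVec v - (NormedSpace.exp (-(t • symPart B))).mulVec v) i ^ 2 ≤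
      Real.exp 1 * (τ * hi / 2) ^ 2 * t ^ 2 * Real.exp (-(2 * lo * t)) * ∑ i, v i ^ 2 := by
  set H := symPart B with hH
  set K := skewPart B with hK
  set zB : ℝ → Fin 3 → ℝ := fun s => (NormedSpace.exp (-(s • B))).mulVec v with hzB
  set zH : ℝ → Fin 3 → ℝ := fun s => (NormedSpace.exp (-(s • H))).mulVec v with hzH
  set w : ℝ → Fin 3 → ℝ := fun s => zB s - zH s with hw
  set V := ∑ i, v i ^ 2 with hV
  set E : ℝ → ℝ := fun s => ∑ i, w s i ^ 2 with hE
  have hV0 : 0 ≤ V := Finset.sum_nonneg fun i _ => sq_nonneg _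
  -- the case t = 0
  rcases ht.eq_or_lt with h0 | htpos
  · rw [← h0]
    simp
  -- derivative of w
  have hwd : ∀ s, HasDerivAt w (-(B.mulVec (zB s)) - -(H.mulVec (zH s))) s := fun s =>
    (hasDerivAt_exp_neg_smul_mulVec B v s).sub (hasDerivAt_exp_neg_smul_mulVec H v s)
  -- rewrite the derivative: -B zB + H zH = -(B w) - K zH
  have hderiv_eq : ∀ s, -(B.mulVec (zB s)) - -(H.mulVec (zH s)) = -(B.mulVec (w s)) - K.mulVec (zH s) := by
    intro s
    have h1 : zB s = w s + zH s := by simp [hw]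
    have h2 : K = B - H := eq_sub_of_add_eq' (symPart_add_skewPart B)
    rw [h1, Matrix.mulVec_add, h2, Matrix.sub_mulVec]
    abel
  -- derivative of the energy
  have hEd : ∀ s, HasDerivAt E (∑ i, 2 * w s i * (-(B.mulVec (w s)) - K.mulVec (zH s)) i) s := by
    intro s
    have h := (hwd s)
    rw [hderiv_eq s, hasDerivAt_pi] at h
    have h2 := HasDerivAt.fun_sum (u := Finset.univ) fun i _ => (h i).fun_pow 2
    refine h2.congr_deriv (Finset.sum_congr rfl fun i _ => ?_)
    simp only [Nat.cast_ofNat, Nat.add_one_sub_one, pow_one]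
  -- the differential inequality, for s ≥ 0 and any μ > 0
  have hineq : ∀ μ : ℝ, 0 < μ → ∀ s : ℝ, 0 ≤ s →
      ∑ i, 2 * w s i * (-(B.mulVec (w s)) - K.mulVec (zH s)) i ≤
        (μ - 2 * lo) * E s + (τ * hi / 2) ^ 2 * V * Real.exp (-(2 * lo * s)) / μ := by
    intro μ hμ s hs
    -- split the sum
    have hsplit : ∑ i, 2 * w s i * (-(B.mulVec (w s)) - K.mulVec (zH s)) i =
        -2 * (w s ⬝ᵥ B *ᵥ w s) + ∑ i, (-2) * (w s i * K.mulVec (zH s) i) := by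
      simp only [dotProduct, Pi.sub_apply, Pi.neg_apply, Finset.mul_sum, ← Finset.sum_add_distrib]
      refine Finset.sum_congr rfl fun i _ => ?_
      ring
    rw [hsplit]
    have hBw : lo * E s ≤ w s ⬝ᵥ B *ᵥ w s := by
      have := (hwin (w s)).1
      rw [self_dotProduct_eq_sum_sq] at this
      exact this
    -- termwise AM-GM: -2ab ≤ μ a² + b²/μ
    have hamgm : ∑ i, (-2) * (w s i * K.mulVec (zH s) i) ≤ μ * E s + (∑ i, K.mulVec (zH s) i ^ 2) / μ := by
      rw [hE]
      simp only
      rw [Finset.mul_sum, Finset.sum_div, ← Finset.sum_add_distrib]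
      refine Finset.sum_le_sum fun i _ => ?_
      have hsq : 0 ≤ (μ * w s i + K.mulVec (zH s) i) ^ 2 / μ := div_nonneg (sq_nonneg _) hμ.le
      have hexp : (μ * w s i + K.mulVec (zH s) i) ^ 2 / μ =
          μ * w s i ^ 2 + 2 * (w s i * K.mulVec (zH s) i) + K.mulVec (zH s) i ^ 2 / μ := by
        field_simp
        ring
      linarith
    have hKz : ∑ i, K.mulVec (zH s) i ^ 2 ≤ (τ * hi / 2) ^ 2 * ∑ i, zH s i ^ 2 := skewPart_sq_le hlo hsec hwin (zH s)
    have hzH : ∑ i, zH s i ^ 2 ≤ Real.exp (-(2 * lo * s)) * V :=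
      sum_sq_exp_neg_smul_mulVec_le H (fun x => (window_symPart_sum hwin x).1) v hs
    have hc : (∑ i, K.mulVec (zH s) i ^ 2) / μ ≤ (τ * hi / 2) ^ 2 * V * Real.exp (-(2 * lo * s)) / μ := by
      refine div_le_div_of_nonneg_right ?_ hμ.le
      calc ∑ i, K.mulVec (zH s) i ^ 2 ≤ (τ * hi / 2) ^ 2 * ∑ i, zH s i ^ 2 := hKz
        _ ≤ (τ * hi / 2) ^ 2 * (Real.exp (-(2 * lo * s)) * V) := mul_le_mul_of_nonneg_left hzH (sq_nonneg _)
        _ = (τ * hi / 2) ^ 2 * V * Real.exp (-(2 * lo * s)) := by ring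
    nlinarith
  -- the Lyapunov function Ψ for μ = 1/t
  set μ := 1 / t with hμ
  have hμpos : 0 < μ := by rw [hμ]; positivity
  set D := (τ * hi / 2) ^ 2 * V / μ ^ 2 with hD
  set Ψ : ℝ → ℝ := fun s => Real.exp ((2 * lo - μ) * s) * E s + D * Real.exp (-(μ * s)) with hΨ
  have hΨd : ∀ s, HasDerivAt Ψ (Real.exp ((2 * lo - μ) * s) * (2 * lo - μ) * E s +
      Real.exp ((2 * lo - μ) * s) * (∑ i, 2 * w s i * (-(B.mulVec (w s)) - K.mulVec (zH s)) i) +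
      D * (Real.exp (-(μ * s)) * (-μ))) s := by
    intro s
    have h1 : HasDerivAt (fun s => Real.exp ((2 * lo - μ) * s)) (Real.exp ((2 * lo - μ) * s) * (2 * lo - μ)) s := by
      have := ((hasDerivAt_id s).const_mul (2 * lo - μ)).exp
      simpa using this
    have h2 : HasDerivAt (fun s => Real.exp (-(μ * s))) (Real.exp (-(μ * s)) * (-μ)) s := by
      have := (((hasDerivAt_id s).const_mul μ).neg).exp
      simpa using this
    exact (h1.mul (hEd s)).add (h2.const_mul D)
  have hΨ' : ∀ s, 0 < s → Real.exp ((2 * lo - μ) * s) * (2 * lo - μ) * E s +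
      Real.exp ((2 * lo - μ) * s) * (∑ i, 2 * w s i * (-(B.mulVec (w s)) - K.mulVec (zH s)) i) +
      D * (Real.exp (-(μ * s)) * (-μ)) ≤ 0 := by
    intro s hs
    have hi1 := hineq μ hμpos s hs.le
    have hpos := Real.exp_pos ((2 * lo - μ) * s)
    have hkey : Real.exp ((2 * lo - μ) * s) * ((τ * hi / 2) ^ 2 * V * Real.exp (-(2 * lo * s)) / μ) =
        D * (Real.exp (-(μ * s)) * μ) := by
      rw [hD]
      have he : Real.exp ((2 * lo - μ) * s) * Real.exp (-(2 * lo * s)) = Real.exp (-(μ * s)) := by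
        rw [← Real.exp_add]; congr 1; ring
      field_simp
      rw [← he]
      ring
    nlinarith [mul_le_mul_of_nonneg_left hi1 hpos.le]
  have hanti : AntitoneOn Ψ (Set.Ici 0) := by
    refine antitoneOn_of_hasDerivWithinAt_nonpos (convex_Ici 0)
      (fun s _ => (hΨd s).continuousAt.continuousWithinAt) (fun s hs => (hΨd s).hasDerivWithinAt) ?_
    intro s hs
    rw [interior_Ici] at hs
    exact hΨ' s hs
  have hE0 : E 0 = 0 := by simp [hE, hw, hzB, hzH]
  have hΨ0 : Ψ 0 = D := by simp [hΨ, hE0]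
  have hΨt : Ψ t ≤ D := by
    rw [← hΨ0]
    exact hanti (Set.mem_Ici.2 le_rfl) (Set.mem_Ici.2 ht) ht
  -- unpack: e^{(2lo-μ)t} E t ≤ D (1 - e^{-μ t}) ≤ D μ t
  have h1e : 1 - Real.exp (-(μ * t)) ≤ μ * t := by
    have := Real.add_one_le_exp (-(μ * t))
    linarith
  have hDnn : 0 ≤ D := by rw [hD]; positivity
  have hEt : Real.exp ((2 * lo - μ) * t) * E t ≤ D * (μ * t) := by
    have : Real.exp ((2 * lo - μ) * t) * E t ≤ D * (1 - Real.exp (-(μ * t))) := by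
      have h := hΨt; simp only [hΨ] at h; linarith
    exact this.trans (mul_le_mul_of_nonneg_left h1e hDnn)
  -- conclude with μ t = 1 and e^{-(2lo-μ)t} = e · e^{-2lo t}
  have hμt : μ * t = 1 := by rw [hμ]; field_simp
  have hexp : Real.exp (-((2 * lo - μ) * t)) = Real.exp 1 * Real.exp (-(2 * lo * t)) := by
    rw [← Real.exp_add]; congr 1
    have : μ * t = 1 := hμt
    linear_combination this
  have hEt' : E t ≤ Real.exp (-((2 * lo - μ) * t)) * (D * (μ * t)) := by
    have hpos := Real.exp_pos ((2 * lo - μ) * t)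
    have h := (le_div_iff₀' hpos).2 hEt
    rw [Real.exp_neg, inv_mul_eq_div]
    exact h
  have hDμ : D * (μ * t) = (τ * hi / 2) ^ 2 * t ^ 2 * V := by
    rw [hD, hμt, mul_one, hμ]
    field_simp
  calc E t ≤ Real.exp (-((2 * lo - μ) * t)) * (D * (μ * t)) := hEt'
    _ = Real.exp 1 * (τ * hi / 2) ^ 2 * t ^ 2 * Real.exp (-(2 * lo * t)) * V := by
      rw [hexp, hDμ]; ring

/-- The two-rate scalar kernel `u ↦ e^{−u·hi} − c · u e^{−u·lo}`. -/
def twoRateKernel (hi lo c : ℝ) (u : ℝ) : ℝ := Real.exp (-u * hi) - c * (u * Real.exp (-u * lo))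

theorem continuous_twoRateKernel (hi lo c : ℝ) : Continuous (twoRateKernel hi lo c) := by
  unfold twoRateKernel; fun_prop

/-- **Pointwise lower semigroup bound for a sectorial block**: for `t ≥ 0`,
`(e^{−hi t} − √e (τhi/2) t e^{−lo t}) Σvᵢ² ≤ vᵀ e^{−tB} v`  (symmetric Loewner pinch for `H` + the Duhamel defect). [folklore] -/
theorem twoRateKernel_mul_le_form_exp {B : Matrix (Fin 3) (Fin 3) ℝ} {τ lo hi : ℝ} (hτ : 0 ≤ τ) (hlo : 0 < lo)
    (hsec : ∀ x z : Fin 3 → ℝ, (x ⬝ᵥ B *ᵥ z - z ⬝ᵥ B *ᵥ x) ^ 2 ≤ τ ^ 2 * ((x ⬝ᵥ B *ᵥ x) * (z ⬝ᵥ B *ᵥ z)))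
    (hwin : ∀ x : Fin 3 → ℝ, lo * (x ⬝ᵥ x) ≤ x ⬝ᵥ B *ᵥ x ∧ x ⬝ᵥ B *ᵥ x ≤ hi * (x ⬝ᵥ x)) (v : Fin 3 → ℝ) {t : ℝ} (ht : 0 ≤ t) :
    twoRateKernel hi lo (Real.sqrt (Real.exp 1) * (τ * hi / 2)) t * ∑ i, v i ^ 2 ≤
      ∑ i, v i * (NormedSpace.exp (-(t • B))).mulVec v i := by
  set H := symPart B with hH
  set zB := (NormedSpace.exp (-(t • B))).mulVec v with hzB
  set zH := (NormedSpace.exp (-(t • H))).mulVec v with hzH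
  set w := zB - zH with hw
  set V := ∑ i, v i ^ 2 with hV
  have hV0 : 0 ≤ V := Finset.sum_nonneg fun i _ => sq_nonneg _
  have hhi : 0 ≤ hi := hlo.le.trans (lo_le_hi_of_window hwin)
  -- the symmetric part: Loewner pinch from below
  have h1 : Real.exp (-(hi * t)) * V ≤ ∑ i, v i * zH i :=
    le_dotProduct_exp_neg_smul_mulVec (symPart_isSymm B) (fun x => (window_symPart_sum hwin x).2) v ht
  -- the defect: Cauchy–Schwarz + the energy estimate
  have hE : ∑ i, w i ^ 2 ≤ Real.exp 1 * (τ * hi / 2) ^ 2 * t ^ 2 * Real.exp (-(2 * lo * t)) * V :=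
    duhamel_defect_sq_le hlo.le hsec hwin v ht
  set c := Real.sqrt (Real.exp 1) * (τ * hi / 2) * t * Real.exp (-(lo * t)) with hc
  have hc0 : 0 ≤ c := by rw [hc]; positivity
  have hcs : (∑ i, v i * w i) ^ 2 ≤ (c * V) ^ 2 := by
    have hCS := Finset.sum_mul_sq_le_sq_mul_sq Finset.univ v w
    have hs : Real.sqrt (Real.exp 1) ^ 2 = Real.exp 1 := Real.sq_sqrt (Real.exp_pos 1).le
    have he2 : Real.exp (-(lo * t)) ^ 2 = Real.exp (-(2 * lo * t)) := by
      rw [sq, ← Real.exp_add]; congr 1; ring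
    have hc2 : (c * V) ^ 2 = (Real.exp 1 * (τ * hi / 2) ^ 2 * t ^ 2 * Real.exp (-(2 * lo * t)) * V) * V := by
      calc (c * V) ^ 2 = Real.sqrt (Real.exp 1) ^ 2 * (τ * hi / 2) ^ 2 * t ^ 2 * Real.exp (-(lo * t)) ^ 2 * V * V := by
            rw [hc]; ring
        _ = (Real.exp 1 * (τ * hi / 2) ^ 2 * t ^ 2 * Real.exp (-(2 * lo * t)) * V) * V := by rw [hs, he2]
    calc (∑ i, v i * w i) ^ 2 ≤ V * ∑ i, w i ^ 2 := by rw [hV]; exact hCS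
      _ ≤ V * (Real.exp 1 * (τ * hi / 2) ^ 2 * t ^ 2 * Real.exp (-(2 * lo * t)) * V) := mul_le_mul_of_nonneg_left hE hV0
      _ = (c * V) ^ 2 := by rw [hc2]; ring
  have h2 : -(c * V) ≤ ∑ i, v i * w i := (abs_le_of_sq_le_sq' hcs (mul_nonneg hc0 hV0)).1
  -- assemble
  have hsplit : ∑ i, v i * zB i = ∑ i, v i * zH i + ∑ i, v i * w i := by
    rw [← Finset.sum_add_distrib]
    refine Finset.sum_congr rfl fun i _ => ?_
    simp only [hw, Pi.sub_apply]; ring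
  rw [hsplit]
  have hk : twoRateKernel hi lo (Real.sqrt (Real.exp 1) * (τ * hi / 2)) t * V = Real.exp (-(hi * t)) * V - c * V := by
    rw [hc, twoRateKernel]
    have e1 : Real.exp (-t * hi) = Real.exp (-(hi * t)) := by congr 1; ring
    have e2 : Real.exp (-t * lo) = Real.exp (-(lo * t)) := by congr 1; ring
    rw [e1, e2]; ring
  rw [hk]
  linarith

/-- **Kernel integration** (the shape of `le_sum_sum_mul_qsResp_mul` with a general continuous scalar minorant `g`):
`g(t) Σvᵢ² ≤ vᵀe^{−tB}v` for `t ≥ 0` gives `T∫∫ a a g(T(s−x)) · Σvᵢ² ≤ vᵀ f_T(B) v` (`T ≥ 0`, weights `a ≥ 0`). [folklore] -/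
theorem kernel_mul_le_sum_sum_mul_qsResp_mul {ρ T : ℝ} (hT : 0 ≤ T) {B : Matrix (Fin 3) (Fin 3) ℝ} {v : Fin 3 → ℝ}
    {g : ℝ → ℝ} (hg : Continuous g)
    (hv : ∀ t : ℝ, 0 ≤ t → g t * ∑ i, v i ^ 2 ≤ ∑ i, v i * (NormedSpace.exp (-(t • B))).mulVec v i) :
    (T * ∫ s in (0:ℝ)..1, LatticeShear.LatticeWord.trapezoid 0 1 ρ s *
      ∫ x in (0:ℝ)..s, LatticeShear.LatticeWord.trapezoid 0 1 ρ x * g (T * (s - x))) * ∑ i, v i ^ 2 ≤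
      ∑ i, ∑ j, v i * qsResp ρ T B i j * v j := by
  rw [sum_sum_mul_qsResp_mul]
  rw [mul_assoc]
  refine mul_le_mul_of_nonneg_left ?_ hT
  rw [← intervalIntegral.integral_mul_const]
  have hsc : Continuous fun p : ℝ × ℝ => g (T * (p.1 - p.2)) := hg.comp (by fun_prop)
  refine intervalIntegral.integral_mono_on zero_le_one ?_ ?_ fun s hs => ?_
  · have hf : Continuous (Function.uncurry fun s x : ℝ => LatticeShear.LatticeWord.trapezoid 0 1 ρ x *
        g (T * (s - x))) :=
      ((continuous_trapezoid_unit ρ).comp continuous_snd).mul hsc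
    exact (((continuous_trapezoid_unit ρ).mul
      (intervalIntegral.continuous_parametric_intervalIntegral_of_continuous (a₀ := 0) hf
        continuous_id)).mul continuous_const).intervalIntegrable _ _
  · have hf : Continuous (Function.uncurry fun s x : ℝ => LatticeShear.LatticeWord.trapezoid 0 1 ρ x *
        ∑ i, ∑ j, v i * (NormedSpace.exp (-(T * (s - x)) • B)) i j * v j) :=
      ((continuous_trapezoid_unit ρ).comp continuous_snd).mul (continuous_qsKernel_bilin T B v v)
    exact ((continuous_trapezoid_unit ρ).mul
      (intervalIntegral.continuous_parametric_intervalIntegral_of_continuous (a₀ := 0) hf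
        continuous_id)).intervalIntegrable _ _
  · rw [mul_assoc]
    refine mul_le_mul_of_nonneg_left ?_ (trapezoid_unit_nonneg ρ s)
    rw [← intervalIntegral.integral_mul_const]
    refine intervalIntegral.integral_mono_on hs.1 ?_ ?_ fun x hx => ?_
    · exact (((continuous_trapezoid_unit ρ).mul
        (hsc.comp (continuous_const.prodMk continuous_id))).mul continuous_const).intervalIntegrable _ _
    · exact ((continuous_trapezoid_unit ρ).mul
        ((continuous_qsKernel_bilin T B v v).comp (continuous_const.prodMk continuous_id))).intervalIntegrable _ _
    · rw [mul_assoc]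
      refine mul_le_mul_of_nonneg_left ?_ (trapezoid_unit_nonneg ρ x)
      have hτ : 0 ≤ T * (s - x) := mul_nonneg hT (by linarith [hx.2])
      have h := hv (T * (s - x)) hτ
      rw [neg_smul, ← sum_mul_mulVec_eq_sum_sum]
      exact h

/-- **Scalar identification** of the two-rate kernel: `T∫∫ a a (e^{−T(s−x)hi} − c T(s−x) e^{−T(s−x)lo}) = f_T(hi) − c g_T(lo)`. -/
theorem kernel_twoRate_eq (ρ T hi lo c : ℝ) :
    T * ∫ s in (0:ℝ)..1, LatticeShear.LatticeWord.trapezoid 0 1 ρ s *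
      ∫ x in (0:ℝ)..s, LatticeShear.LatticeWord.trapezoid 0 1 ρ x * twoRateKernel hi lo c (T * (s - x)) =
      qsRespScalar ρ T hi - c * qsRespMoment ρ T lo := by
  unfold qsRespScalar qsRespMoment twoRateKernel
  set a : ℝ → ℝ := fun s => LatticeShear.LatticeWord.trapezoid 0 1 ρ s with ha
  have hac : Continuous a := continuous_trapezoid_unit ρ
  -- inner integrals
  set e₁ : ℝ → ℝ → ℝ := fun s x => a x * Real.exp (-(T * (s - x)) * hi) with he₁
  set e₂ : ℝ → ℝ → ℝ := fun s x => a x * ((T * (s - x)) * Real.exp (-(T * (s - x)) * lo)) with he₂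
  have hc₁ : Continuous (Function.uncurry e₁) := by
    simp only [he₁, ha]; exact ((continuous_trapezoid_unit ρ).comp continuous_snd).mul (by fun_prop)
  have hc₂ : Continuous (Function.uncurry e₂) := by
    simp only [he₂, ha]; exact ((continuous_trapezoid_unit ρ).comp continuous_snd).mul (by fun_prop)
  have hinner : ∀ s, ∫ x in (0:ℝ)..s, a x * (Real.exp (-(T * (s - x)) * hi) - c * ((T * (s - x)) * Real.exp (-(T * (s - x)) * lo))) =
      (∫ x in (0:ℝ)..s, e₁ s x) - c * ∫ x in (0:ℝ)..s, e₂ s x := by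
    intro s
    have i₁ : IntervalIntegrable (e₁ s) MeasureTheory.volume 0 s :=
      (hc₁.comp (continuous_const.prodMk continuous_id)).intervalIntegrable _ _
    have i₂ : IntervalIntegrable (fun x => c * e₂ s x) MeasureTheory.volume 0 s :=
      (continuous_const.mul (hc₂.comp (continuous_const.prodMk continuous_id))).intervalIntegrable _ _
    rw [← intervalIntegral.integral_const_mul, ← intervalIntegral.integral_sub i₁ i₂]
    refine intervalIntegral.integral_congr fun x _ => ?_
    simp only [he₁, he₂]; ring
  have hI₁ : Continuous fun s => ∫ x in (0:ℝ)..s, e₁ s x :=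
    intervalIntegral.continuous_parametric_intervalIntegral_of_continuous (a₀ := 0) hc₁ continuous_id
  have hI₂ : Continuous fun s => ∫ x in (0:ℝ)..s, e₂ s x :=
    intervalIntegral.continuous_parametric_intervalIntegral_of_continuous (a₀ := 0) hc₂ continuous_id
  have houter : ∫ s in (0:ℝ)..1, a s * ∫ x in (0:ℝ)..s, a x * (Real.exp (-(T * (s - x)) * hi) -
      c * ((T * (s - x)) * Real.exp (-(T * (s - x)) * lo))) =
      (∫ s in (0:ℝ)..1, a s * ∫ x in (0:ℝ)..s, e₁ s x) - c * ∫ s in (0:ℝ)..1, a s * ∫ x in (0:ℝ)..s, e₂ s x := by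
    have j₁ : IntervalIntegrable (fun s => a s * ∫ x in (0:ℝ)..s, e₁ s x) MeasureTheory.volume 0 1 :=
      (hac.mul hI₁).intervalIntegrable _ _
    have j₂ : IntervalIntegrable (fun s => c * (a s * ∫ x in (0:ℝ)..s, e₂ s x)) MeasureTheory.volume 0 1 :=
      (continuous_const.mul (hac.mul hI₂)).intervalIntegrable _ _
    rw [← intervalIntegral.integral_const_mul, ← intervalIntegral.integral_sub j₁ j₂]
    refine intervalIntegral.integral_congr fun s _ => ?_
    show _ = a s * (∫ x in (0:ℝ)..s, e₁ s x) - c * (a s * ∫ x in (0:ℝ)..s, e₂ s x)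
    rw [hinner s]; ring
  simp only [ha, he₁, he₂] at houter
  rw [houter]
  ring

/-- **The first-order lower window edge for sectorial blocks, with constant `√e`** (cf. the typed target `LowerEdgeTarget`, which has
constant `1` in place of `√e ≈ 1.6487`): for `T ≥ 0`, `B` in the Kato sector of half-angle `arctan(τ/2)`, `τ ≥ 0`, with numerical range in
`[lo, hi]`, `0 < lo`:  `(f_T(hi) − √e (τhi/2) g_T(lo)) |v|² ≤ vᵀ f_T(B) v`. -/
def LowerEdgeTargetE (ρ : ℝ) : Prop :=
  ∀ T : ℝ, 0 ≤ T → ∀ (B : Matrix (Fin 3) (Fin 3) ℝ) (τ lo hi : ℝ), 0 ≤ τ → 0 < lo →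
    (∀ x z : Fin 3 → ℝ, (x ⬝ᵥ B *ᵥ z - z ⬝ᵥ B *ᵥ x) ^ 2 ≤ τ ^ 2 * ((x ⬝ᵥ B *ᵥ x) * (z ⬝ᵥ B *ᵥ z))) →
    (∀ x : Fin 3 → ℝ, lo * (x ⬝ᵥ x) ≤ x ⬝ᵥ B *ᵥ x ∧ x ⬝ᵥ B *ᵥ x ≤ hi * (x ⬝ᵥ x)) →
    ∀ v : Fin 3 → ℝ,
      (qsRespScalar ρ T hi - Real.sqrt (Real.exp 1) * (τ * hi / 2) * qsRespMoment ρ T lo) * (v ⬝ᵥ v) ≤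
        v ⬝ᵥ (qsResp ρ T B) *ᵥ v

/-- **PROVED.** -/
theorem lowerEdgeTargetE_holds (ρ : ℝ) : LowerEdgeTargetE ρ := by
  intro T hT B τ lo hi hτ hlo hsec hwin v
  have h := kernel_mul_le_sum_sum_mul_qsResp_mul (ρ := ρ) hT
    (continuous_twoRateKernel hi lo (Real.sqrt (Real.exp 1) * (τ * hi / 2)))
    (fun t ht => twoRateKernel_mul_le_form_exp hτ hlo hsec hwin v ht)
  rw [kernel_twoRate_eq, ← self_dotProduct_eq_sum_sq, sum_sum_eq_form] at h
  exact h

/-- Bookkeeping (the shape of `window_clause_of_lowerEdgeTarget`, now UNCONDITIONAL): the slot window for a sectorial block in the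
`perpSq`/`projPerp` currency of `oddSectorial_excQS_strict_of_slotWindows` (§4), with `ylo = f_T(hi) − √e(τhi/2) g_T(lo)` and `yhi = f_T(lo)`
(times the slot mass). -/
theorem window_clause_sectorial {ρ T : ℝ} (hT : 0 ≤ T) {B : Matrix (Fin 3) (Fin 3) ℝ}
    {τ lo hi : ℝ} (hτ : 0 ≤ τ) (hlo : 0 < lo)
    (hsec : ∀ x z : Fin 3 → ℝ, (x ⬝ᵥ B *ᵥ z - z ⬝ᵥ B *ᵥ x) ^ 2 ≤ τ ^ 2 * ((x ⬝ᵥ B *ᵥ x) * (z ⬝ᵥ B *ᵥ z)))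
    (hwin : ∀ x : Fin 3 → ℝ, lo * (x ⬝ᵥ x) ≤ x ⬝ᵥ B *ᵥ x ∧ x ⬝ᵥ B *ᵥ x ≤ hi * (x ⬝ᵥ x)) (s : Fin 26) (x : Fin 3 → ℝ) :
    (qsRespScalar ρ T hi - Real.sqrt (Real.exp 1) * (τ * hi / 2) * qsRespMoment ρ T lo) * perpSq (slotN s) x ≤
      ((projPerp (slotN s)) *ᵥ x) ⬝ᵥ (qsResp ρ T B) *ᵥ ((projPerp (slotN s)) *ᵥ x) ∧
    ((projPerp (slotN s)) *ᵥ x) ⬝ᵥ (qsResp ρ T B) *ᵥ ((projPerp (slotN s)) *ᵥ x) ≤ qsRespScalar ρ T lo * perpSq (slotN s) x := by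
  have hn : ∑ a, slotN s a ^ 2 = 1 := by rw [← self_dotProduct_eq_sum_sq]; exact slotN_unit s
  refine ⟨?_, qsResp_window_upper_projPerp hT (fun x => (hwin x).1) s x⟩
  rw [← perpSq_eq_projPerp (slotN s) x hn]
  exact lowerEdgeTargetE_holds ρ T hT B τ lo hi hτ hlo hsec hwin _

end LowerEdge


/-! ## §7 THE CONSTANT UPGRADE `√e → 1`: the typed target `LowerEdgeTarget` PROVED
(`√`-regularised Lyapunov function `Φ_ε(s) = e^{lo s}√(|w(s)|² + ε²) − (τhi/2)|v|·s − ε e^{lo s}`, then `ε → 0`) -/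

section LowerEdgeSharpConstant

open Literature.Analysis Literature.Analysis.FunctionSpaces Literature.Analysis.FluidPDE
open Literature.Analysis.FluidPDE.LatticeShear
open Literature.Analysis.ODE.PeriodicAveraging

/-- **The energy estimate for the Duhamel defect with the sharp first-order constant**:
`Σ wᵢ(t)² ≤ (τhi/2)² t² e^{−2lo t} Σ vᵢ²` (`t ≥ 0`), i.e. `|e^{−tB}v − e^{−tH}v| ≤ (τhi/2)·t·e^{−lo t}|v|`. [folklore] -/
theorem duhamel_defect_sq_le_one {B : Matrix (Fin 3) (Fin 3) ℝ} {τ lo hi : ℝ} (hτ : 0 ≤ τ) (hlo : 0 ≤ lo) (hhi : 0 ≤ hi)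
    (hsec : ∀ x z : Fin 3 → ℝ, (x ⬝ᵥ B *ᵥ z - z ⬝ᵥ B *ᵥ x) ^ 2 ≤ τ ^ 2 * ((x ⬝ᵥ B *ᵥ x) * (z ⬝ᵥ B *ᵥ z)))
    (hwin : ∀ x : Fin 3 → ℝ, lo * (x ⬝ᵥ x) ≤ x ⬝ᵥ B *ᵥ x ∧ x ⬝ᵥ B *ᵥ x ≤ hi * (x ⬝ᵥ x)) (v : Fin 3 → ℝ) {t : ℝ} (ht : 0 ≤ t) :
    ∑ i, ((NormedSpace.exp (-(t • B))).mulVec v - (NormedSpace.exp (-(t • symPart B))).mulVec v) i ^ 2 ≤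
      (τ * hi / 2) ^ 2 * t ^ 2 * Real.exp (-(2 * lo * t)) * ∑ i, v i ^ 2 := by
  set H := symPart B with hH
  set K := skewPart B with hK
  set zB : ℝ → Fin 3 → ℝ := fun s => (NormedSpace.exp (-(s • B))).mulVec v with hzB
  set zH : ℝ → Fin 3 → ℝ := fun s => (NormedSpace.exp (-(s • H))).mulVec v with hzH
  set w : ℝ → Fin 3 → ℝ := fun s => zB s - zH s with hw
  set V := ∑ i, v i ^ 2 with hV
  set E : ℝ → ℝ := fun s => ∑ i, w s i ^ 2 with hE
  have hV0 : 0 ≤ V := Finset.sum_nonneg fun i _ => sq_nonneg _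
  have hE0' : ∀ s, 0 ≤ E s := fun s => Finset.sum_nonneg fun i _ => sq_nonneg _
  set a := τ * hi / 2 * Real.sqrt V with ha
  have ha0 : 0 ≤ a := by rw [ha]; positivity
  -- derivative of w and of the energy (as in `duhamel_defect_sq_le`)
  have hwd : ∀ s, HasDerivAt w (-(B.mulVec (zB s)) - -(H.mulVec (zH s))) s := fun s =>
    (hasDerivAt_exp_neg_smul_mulVec B v s).sub (hasDerivAt_exp_neg_smul_mulVec H v s)
  have hderiv_eq : ∀ s, -(B.mulVec (zB s)) - -(H.mulVec (zH s)) = -(B.mulVec (w s)) - K.mulVec (zH s) := by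
    intro s
    have h1 : zB s = w s + zH s := by simp [hw]
    have h2 : K = B - H := eq_sub_of_add_eq' (symPart_add_skewPart B)
    rw [h1, Matrix.mulVec_add, h2, Matrix.sub_mulVec]
    abel
  have hEd : ∀ s, HasDerivAt E (∑ i, 2 * w s i * (-(B.mulVec (w s)) - K.mulVec (zH s)) i) s := by
    intro s
    have h := (hwd s)
    rw [hderiv_eq s, hasDerivAt_pi] at h
    have h2 := HasDerivAt.fun_sum (u := Finset.univ) fun i _ => (h i).fun_pow 2
    refine h2.congr_deriv (Finset.sum_congr rfl fun i _ => ?_)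
    simp only [Nat.cast_ofNat, Nat.add_one_sub_one, pow_one]
  -- the SHARP differential inequality: E' ≤ -2 lo E + 2 √E · a e^{-lo s}   (s ≥ 0)
  have hineq : ∀ s : ℝ, 0 ≤ s →
      ∑ i, 2 * w s i * (-(B.mulVec (w s)) - K.mulVec (zH s)) i ≤
        -2 * lo * E s + 2 * Real.sqrt (E s) * (a * Real.exp (-(lo * s))) := by
    intro s hs
    have hsplit : ∑ i, 2 * w s i * (-(B.mulVec (w s)) - K.mulVec (zH s)) i =
        -2 * (w s ⬝ᵥ B *ᵥ w s) + 2 * ∑ i, (-w s i) * K.mulVec (zH s) i := by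
      simp only [dotProduct, Pi.sub_apply, Pi.neg_apply, Finset.mul_sum, ← Finset.sum_add_distrib]
      refine Finset.sum_congr rfl fun i _ => ?_
      ring
    rw [hsplit]
    have hBw : lo * E s ≤ w s ⬝ᵥ B *ᵥ w s := by
      have := (hwin (w s)).1
      rw [self_dotProduct_eq_sum_sq] at this
      exact this
    have hCS : ∑ i, (-w s i) * K.mulVec (zH s) i ≤
        Real.sqrt (∑ i, (-w s i) ^ 2) * Real.sqrt (∑ i, K.mulVec (zH s) i ^ 2) :=
      Real.sum_mul_le_sqrt_mul_sqrt Finset.univ (fun i => -w s i) (fun i => K.mulVec (zH s) i)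
    have hneg : ∑ i, (-w s i) ^ 2 = E s := by
      simp only [hE, neg_sq]
    rw [hneg] at hCS
    have hKz : ∑ i, K.mulVec (zH s) i ^ 2 ≤ (τ * hi / 2) ^ 2 * ∑ i, zH s i ^ 2 := skewPart_sq_le hlo hsec hwin (zH s)
    have hzH : ∑ i, zH s i ^ 2 ≤ Real.exp (-(2 * lo * s)) * V :=
      sum_sq_exp_neg_smul_mulVec_le H (fun x => (window_symPart_sum hwin x).1) v hs
    have hsq : Real.sqrt (∑ i, K.mulVec (zH s) i ^ 2) ≤ a * Real.exp (-(lo * s)) := by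
      rw [Real.sqrt_le_left (by positivity)]
      have he2 : Real.exp (-(lo * s)) ^ 2 = Real.exp (-(2 * lo * s)) := by
        rw [sq, ← Real.exp_add]; congr 1; ring
      calc ∑ i, K.mulVec (zH s) i ^ 2 ≤ (τ * hi / 2) ^ 2 * (Real.exp (-(2 * lo * s)) * V) :=
            hKz.trans (mul_le_mul_of_nonneg_left hzH (sq_nonneg _))
        _ = (a * Real.exp (-(lo * s))) ^ 2 := by
            rw [ha, mul_pow, mul_pow, Real.sq_sqrt hV0, he2]; ring
    have hsE : 0 ≤ Real.sqrt (E s) := Real.sqrt_nonneg _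
    nlinarith [mul_le_mul_of_nonneg_left hsq hsE]
  -- the regularised Lyapunov function, for ε > 0
  have main : ∀ ε : ℝ, 0 < ε → Real.exp (lo * t) * Real.sqrt (E t) ≤ a * t + ε * Real.exp (lo * t) := by
    intro ε hε
    set Φ : ℝ → ℝ := fun s => Real.exp (lo * s) * Real.sqrt (E s + ε ^ 2) - a * s - ε * Real.exp (lo * s) with hΦ
    have hRpos : ∀ s, 0 < E s + ε ^ 2 := fun s => by positivity
    have hΦd : ∀ s, HasDerivAt Φ (Real.exp (lo * s) * lo * Real.sqrt (E s + ε ^ 2) +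
        Real.exp (lo * s) * ((∑ i, 2 * w s i * (-(B.mulVec (w s)) - K.mulVec (zH s)) i) / (2 * Real.sqrt (E s + ε ^ 2))) -
        a - ε * (Real.exp (lo * s) * lo)) s := by
      intro s
      have h1 : HasDerivAt (fun s => Real.exp (lo * s)) (Real.exp (lo * s) * lo) s := by
        have := ((hasDerivAt_id s).const_mul lo).exp
        simpa using this
      have h2 : HasDerivAt (fun s => Real.sqrt (E s + ε ^ 2))
          ((∑ i, 2 * w s i * (-(B.mulVec (w s)) - K.mulVec (zH s)) i) / (2 * Real.sqrt (E s + ε ^ 2))) s := by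
        have := ((hEd s).add_const (ε ^ 2)).sqrt (hRpos s).ne'
        simpa using this
      have h3 : HasDerivAt (fun s => a * s) a s := by simpa using (hasDerivAt_id s).const_mul a
      exact ((h1.mul h2).sub h3).sub (h1.const_mul ε)
    have hΦ' : ∀ s, 0 < s → Real.exp (lo * s) * lo * Real.sqrt (E s + ε ^ 2) +
        Real.exp (lo * s) * ((∑ i, 2 * w s i * (-(B.mulVec (w s)) - K.mulVec (zH s)) i) / (2 * Real.sqrt (E s + ε ^ 2))) -
        a - ε * (Real.exp (lo * s) * lo) ≤ 0 := by
      intro s hs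
      set R := Real.sqrt (E s + ε ^ 2) with hR
      set D := ∑ i, 2 * w s i * (-(B.mulVec (w s)) - K.mulVec (zH s)) i with hDdef
      have hR0 : 0 < R := Real.sqrt_pos.2 (hRpos s)
      have hR2 : R ^ 2 = E s + ε ^ 2 := Real.sq_sqrt (hRpos s).le
      have hEs := hE0' s
      have hsqE : Real.sqrt (E s) ≤ R := Real.sqrt_le_sqrt (by nlinarith)
      have hsqE0 : 0 ≤ Real.sqrt (E s) := Real.sqrt_nonneg _
      have hsqE2 : Real.sqrt (E s) ^ 2 = E s := Real.sq_sqrt hEs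
      have hεR : ε ≤ R := by
        have : Real.sqrt (ε ^ 2) ≤ R := Real.sqrt_le_sqrt (by nlinarith)
        rwa [Real.sqrt_sq hε.le] at this
      have hexp := Real.exp_pos (lo * s)
      have hee : Real.exp (lo * s) * Real.exp (-(lo * s)) = 1 := by rw [← Real.exp_add, add_neg_cancel, Real.exp_zero]
      set b := a * Real.exp (-(lo * s)) with hb
      have hb0 : 0 ≤ b := by rw [hb]; positivity
      have hDle : D ≤ -2 * lo * E s + 2 * Real.sqrt (E s) * b := hineq s hs.le
      -- the bracket: lo R + D/(2R) - ε lo ≤ b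
      have hbr : lo * R + D / (2 * R) - ε * lo ≤ b := by
        have h2R : 0 < 2 * R := by positivity
        have hdiv : D / (2 * R) ≤ (-2 * lo * E s + 2 * Real.sqrt (E s) * b) / (2 * R) :=
          div_le_div_of_nonneg_right hDle h2R.le
        have hkey : lo * R + (-2 * lo * E s + 2 * Real.sqrt (E s) * b) / (2 * R) - ε * lo ≤ b := by
          rw [← sub_nonpos]
          have : lo * R + (-2 * lo * E s + 2 * Real.sqrt (E s) * b) / (2 * R) - ε * lo - b =
              (lo * ε * (ε - R) + (b * (Real.sqrt (E s) - R))) / R := by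
            field_simp
            nlinarith [hR2]
          rw [this]
          refine div_nonpos_of_nonpos_of_nonneg ?_ hR0.le
          nlinarith [mul_nonneg hlo hε.le, hb0]
        linarith
      have hab : Real.exp (lo * s) * b = a := by
        rw [hb, ← mul_assoc, mul_comm (Real.exp (lo * s)) a, mul_assoc, hee, mul_one]
      nlinarith [mul_le_mul_of_nonneg_left hbr hexp.le]
    have hanti : AntitoneOn Φ (Set.Ici 0) := by
      refine antitoneOn_of_hasDerivWithinAt_nonpos (convex_Ici 0)
        (fun s _ => (hΦd s).continuousAt.continuousWithinAt) (fun s hs => (hΦd s).hasDerivWithinAt) ?_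
      intro s hs
      rw [interior_Ici] at hs
      exact hΦ' s hs
    have hE0 : E 0 = 0 := by simp [hE, hw, hzB, hzH]
    have hΦ0 : Φ 0 = 0 := by
      simp only [hΦ, hE0, mul_zero, Real.exp_zero, one_mul, zero_add, sub_zero, mul_one]
      rw [Real.sqrt_sq hε.le, sub_self]
    have hΦt : Φ t ≤ 0 := by
      rw [← hΦ0]
      exact hanti (Set.mem_Ici.2 le_rfl) (Set.mem_Ici.2 ht) ht
    have hmono : Real.sqrt (E t) ≤ Real.sqrt (E t + ε ^ 2) := Real.sqrt_le_sqrt (by nlinarith)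
    have hexp := Real.exp_pos (lo * t)
    have h1 : Real.exp (lo * t) * Real.sqrt (E t + ε ^ 2) ≤ a * t + ε * Real.exp (lo * t) := by
      simp only [hΦ] at hΦt; linarith
    exact (mul_le_mul_of_nonneg_left hmono hexp.le).trans h1
  -- ε → 0
  have hlim : Real.exp (lo * t) * Real.sqrt (E t) ≤ a * t := by
    refine le_of_forall_pos_le_add fun ε hε => ?_
    have hexp := Real.exp_pos (lo * t)
    have h := main (ε / Real.exp (lo * t)) (div_pos hε hexp)
    rwa [div_mul_cancel₀ _ hexp.ne'] at h
  -- square it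
  have hexp := Real.exp_pos (lo * t)
  have hsq0 : 0 ≤ Real.exp (lo * t) * Real.sqrt (E t) := by positivity
  have h2 : (Real.exp (lo * t) * Real.sqrt (E t)) ^ 2 ≤ (a * t) ^ 2 := pow_le_pow_left₀ hsq0 hlim 2
  rw [mul_pow, Real.sq_sqrt (hE0' t)] at h2
  have he2 : Real.exp (lo * t) ^ 2 * Real.exp (-(2 * lo * t)) = 1 := by
    rw [sq, ← Real.exp_add, ← Real.exp_add, show lo * t + lo * t + -(2 * lo * t) = 0 by ring, Real.exp_zero]
  have ha2 : a ^ 2 = (τ * hi / 2) ^ 2 * V := by rw [ha, mul_pow, Real.sq_sqrt hV0]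
  have hpos2 := Real.exp_pos (-(2 * lo * t))
  calc E t = Real.exp (lo * t) ^ 2 * E t * Real.exp (-(2 * lo * t)) := by
        rw [mul_comm (Real.exp (lo * t) ^ 2), mul_assoc, he2, mul_one]
    _ ≤ (a * t) ^ 2 * Real.exp (-(2 * lo * t)) := mul_le_mul_of_nonneg_right h2 hpos2.le
    _ = (τ * hi / 2) ^ 2 * t ^ 2 * Real.exp (-(2 * lo * t)) * V := by rw [mul_pow, ha2]; ring

/-- Pointwise, sharp constant: `(e^{−hi t} − (τhi/2)·t·e^{−lo t})|v|² ≤ vᵀe^{−tB}v` (`t ≥ 0`). [folklore] -/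
theorem twoRateKernel_mul_le_form_exp_one {B : Matrix (Fin 3) (Fin 3) ℝ} {τ lo hi : ℝ} (hτ : 0 ≤ τ) (hlo : 0 < lo)
    (hsec : ∀ x z : Fin 3 → ℝ, (x ⬝ᵥ B *ᵥ z - z ⬝ᵥ B *ᵥ x) ^ 2 ≤ τ ^ 2 * ((x ⬝ᵥ B *ᵥ x) * (z ⬝ᵥ B *ᵥ z)))
    (hwin : ∀ x : Fin 3 → ℝ, lo * (x ⬝ᵥ x) ≤ x ⬝ᵥ B *ᵥ x ∧ x ⬝ᵥ B *ᵥ x ≤ hi * (x ⬝ᵥ x)) (v : Fin 3 → ℝ) {t : ℝ} (ht : 0 ≤ t) :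
    twoRateKernel hi lo (τ * hi / 2) t * ∑ i, v i ^ 2 ≤ ∑ i, v i * (NormedSpace.exp (-(t • B))).mulVec v i := by
  set H := symPart B with hH
  set zB := (NormedSpace.exp (-(t • B))).mulVec v with hzB
  set zH := (NormedSpace.exp (-(t • H))).mulVec v with hzH
  set w := zB - zH with hw
  set V := ∑ i, v i ^ 2 with hV
  have hV0 : 0 ≤ V := Finset.sum_nonneg fun i _ => sq_nonneg _
  have hhi : 0 ≤ hi := hlo.le.trans (lo_le_hi_of_window hwin)
  have h1 : Real.exp (-(hi * t)) * V ≤ ∑ i, v i * zH i :=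
    le_dotProduct_exp_neg_smul_mulVec (symPart_isSymm B) (fun x => (window_symPart_sum hwin x).2) v ht
  have hE : ∑ i, w i ^ 2 ≤ (τ * hi / 2) ^ 2 * t ^ 2 * Real.exp (-(2 * lo * t)) * V :=
    duhamel_defect_sq_le_one hτ hlo.le hhi hsec hwin v ht
  set c := (τ * hi / 2) * t * Real.exp (-(lo * t)) with hc
  have hc0 : 0 ≤ c := by rw [hc]; positivity
  have hcs : (∑ i, v i * w i) ^ 2 ≤ (c * V) ^ 2 := by
    have hCS := Finset.sum_mul_sq_le_sq_mul_sq Finset.univ v w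
    have he2 : Real.exp (-(lo * t)) ^ 2 = Real.exp (-(2 * lo * t)) := by
      rw [sq, ← Real.exp_add]; congr 1; ring
    have hc2 : (c * V) ^ 2 = ((τ * hi / 2) ^ 2 * t ^ 2 * Real.exp (-(2 * lo * t)) * V) * V := by
      calc (c * V) ^ 2 = (τ * hi / 2) ^ 2 * t ^ 2 * Real.exp (-(lo * t)) ^ 2 * V * V := by rw [hc]; ring
        _ = ((τ * hi / 2) ^ 2 * t ^ 2 * Real.exp (-(2 * lo * t)) * V) * V := by rw [he2]
    calc (∑ i, v i * w i) ^ 2 ≤ V * ∑ i, w i ^ 2 := by rw [hV]; exact hCS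
      _ ≤ V * ((τ * hi / 2) ^ 2 * t ^ 2 * Real.exp (-(2 * lo * t)) * V) := mul_le_mul_of_nonneg_left hE hV0
      _ = (c * V) ^ 2 := by rw [hc2]; ring
  have h2 : -(c * V) ≤ ∑ i, v i * w i := (abs_le_of_sq_le_sq' hcs (mul_nonneg hc0 hV0)).1
  have hsplit : ∑ i, v i * zB i = ∑ i, v i * zH i + ∑ i, v i * w i := by
    rw [← Finset.sum_add_distrib]
    refine Finset.sum_congr rfl fun i _ => ?_
    simp only [hw, Pi.sub_apply]; ring
  rw [hsplit]
  have hk : twoRateKernel hi lo (τ * hi / 2) t * V = Real.exp (-(hi * t)) * V - c * V := by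
    rw [hc, twoRateKernel]
    have e1 : Real.exp (-t * hi) = Real.exp (-(hi * t)) := by congr 1; ring
    have e2 : Real.exp (-t * lo) = Real.exp (-(lo * t)) := by congr 1; ring
    rw [e1, e2]; ring
  rw [hk]
  linarith

/-- **PROVED: the typed target `LowerEdgeTarget` (constant `1`).**  For `T ≥ 0`, `B` sectorial (`τ ≥ 0`) with window `[lo, hi]` (`0 < lo`), every `v`:
`(f_T(hi) − (τ·hi/2)·g_T(lo))·|v|² ≤ vᵀ f_T(B) v`. -/
theorem lowerEdgeTarget_holds (ρ : ℝ) : LowerEdgeTarget ρ := by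
  intro T hT B τ lo hi hτ hlo hsec hwin v
  have h := kernel_mul_le_sum_sum_mul_qsResp_mul (ρ := ρ) hT (continuous_twoRateKernel hi lo (τ * hi / 2))
    (fun t ht => twoRateKernel_mul_le_form_exp_one hτ hlo hsec hwin v ht)
  rw [kernel_twoRate_eq, ← self_dotProduct_eq_sum_sq, sum_sum_eq_form] at h
  exact h

/-- The slot window clause for a sectorial block, UNCONDITIONAL, sharp first-order constant (`window_clause_of_lowerEdgeTarget` discharged). -/
theorem window_clause_sectorial_one {ρ T : ℝ} (hT : 0 ≤ T) {B : Matrix (Fin 3) (Fin 3) ℝ}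
    {τ lo hi : ℝ} (hτ : 0 ≤ τ) (hlo : 0 < lo)
    (hsec : ∀ x z : Fin 3 → ℝ, (x ⬝ᵥ B *ᵥ z - z ⬝ᵥ B *ᵥ x) ^ 2 ≤ τ ^ 2 * ((x ⬝ᵥ B *ᵥ x) * (z ⬝ᵥ B *ᵥ z)))
    (hwin : ∀ x : Fin 3 → ℝ, lo * (x ⬝ᵥ x) ≤ x ⬝ᵥ B *ᵥ x ∧ x ⬝ᵥ B *ᵥ x ≤ hi * (x ⬝ᵥ x)) (s : Fin 26) (x : Fin 3 → ℝ) :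
    (qsRespScalar ρ T hi - τ * hi / 2 * qsRespMoment ρ T lo) * perpSq (slotN s) x ≤
      ((projPerp (slotN s)) *ᵥ x) ⬝ᵥ (qsResp ρ T B) *ᵥ ((projPerp (slotN s)) *ᵥ x) ∧
    ((projPerp (slotN s)) *ᵥ x) ⬝ᵥ (qsResp ρ T B) *ᵥ ((projPerp (slotN s)) *ᵥ x) ≤ qsRespScalar ρ T lo * perpSq (slotN s) x :=
  window_clause_of_lowerEdgeTarget (lowerEdgeTarget_holds ρ) hT hτ hlo hsec hwin s x

end LowerEdgeSharpConstant


/-! ## §8 A PROVED, LOSSY SUBSTITUTE FOR THE SECTOR-PRESERVATION HYPOTHESIS L1⁺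
(`f_T(B)` is `τ·θ`-sectorial, `θ = hi·g_T(lo)/(f_T(hi) − (τhi/2)g_T(lo))`; admissible at narrow windows `ΛV ≤ 1.03`) -/

section LossySector

open Literature.Analysis Literature.Analysis.FunctionSpaces Literature.Analysis.FluidPDE
open Literature.Analysis.FluidPDE.LatticeShear
open Literature.Analysis.ODE.PeriodicAveraging

/-- Finite double sums with constant coefficients commute with the interval integral (copy of the private helper of p643071). [folklore] -/
theorem integral_sum_sum_mul' {f : Fin 3 → Fin 3 → ℝ → ℝ} {a b : ℝ} (c : Fin 3 → Fin 3 → ℝ)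
    (hf : ∀ i j, IntervalIntegrable (f i j) MeasureTheory.volume a b) :
    ∫ x in a..b, ∑ i, ∑ j, c i j * f i j x = ∑ i, ∑ j, c i j * ∫ x in a..b, f i j x := by
  rw [intervalIntegral.integral_finsetSum]
  · refine Finset.sum_congr rfl fun i _ => ?_
    rw [intervalIntegral.integral_finsetSum]
    · exact Finset.sum_congr rfl fun j _ => intervalIntegral.integral_const_mul _ _
    · exact fun j _ => (hf i j).const_mul _
  · intro i _
    have h := IntervalIntegrable.sum Finset.univ fun j (_ : j ∈ Finset.univ) => (hf i j).const_mul (c i j)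
    rw [Finset.sum_fn] at h
    exact h

/-- **A linear functional of `qsResp` is the double integral of the functional of the kernel** (general coefficients `c i j`;
`sum_sum_mul_qsResp_mul` is the rank-one case `c i j = v i * w j`). [folklore] -/
theorem sum_sum_mul_qsResp_coeff (ρ T : ℝ) (B : Matrix (Fin 3) (Fin 3) ℝ) (c : Fin 3 → Fin 3 → ℝ) :
    ∑ i, ∑ j, c i j * qsResp ρ T B i j =
      T * ∫ s in (0:ℝ)..1, LatticeShear.LatticeWord.trapezoid 0 1 ρ s *
        ∫ x in (0:ℝ)..s, LatticeShear.LatticeWord.trapezoid 0 1 ρ x *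
          ∑ i, ∑ j, c i j * (NormedSpace.exp (-(T * (s - x)) • B)) i j := by
  set α : ℝ → ℝ := fun s => LatticeShear.LatticeWord.trapezoid 0 1 ρ s with hα
  set E : ℝ → ℝ → Fin 3 → Fin 3 → ℝ := fun s x i j => (NormedSpace.exp (-(T * (s - x)) • B)) i j with hE
  have hin : ∀ i j s, IntervalIntegrable (fun x => α x * E s x i j) MeasureTheory.volume 0 s := fun i j s =>
    ((continuous_trapezoid_unit ρ).mul
      ((continuous_qsKernel_apply T B i j).comp (continuous_const.prodMk continuous_id))).intervalIntegrable _ _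
  have hout : ∀ i j, IntervalIntegrable (fun s => α s * ∫ x in (0:ℝ)..s, α x * E s x i j) MeasureTheory.volume 0 1 := by
    intro i j
    have hf : Continuous (Function.uncurry fun s x : ℝ => α x * E s x i j) :=
      ((continuous_trapezoid_unit ρ).comp continuous_snd).mul (continuous_qsKernel_apply T B i j)
    exact ((continuous_trapezoid_unit ρ).mul
      (intervalIntegral.continuous_parametric_intervalIntegral_of_continuous (a₀ := 0) hf
        continuous_id)).intervalIntegrable _ _
  have hinner : ∀ s, ∫ x in (0:ℝ)..s, α x * ∑ i, ∑ j, c i j * E s x i j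
      = ∑ i, ∑ j, c i j * ∫ x in (0:ℝ)..s, α x * E s x i j := by
    intro s
    rw [← integral_sum_sum_mul' c fun i j => hin i j s]
    refine intervalIntegral.integral_congr fun x _ => ?_
    show α x * ∑ i, ∑ j, c i j * E s x i j = ∑ i, ∑ j, c i j * (α x * E s x i j)
    rw [Finset.mul_sum]
    refine Finset.sum_congr rfl fun i _ => ?_
    rw [Finset.mul_sum]
    refine Finset.sum_congr rfl fun j _ => ?_
    ring
  have houter : ∫ s in (0:ℝ)..1, α s * ∫ x in (0:ℝ)..s, α x * ∑ i, ∑ j, c i j * E s x i j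
      = ∑ i, ∑ j, c i j * ∫ s in (0:ℝ)..1, α s * ∫ x in (0:ℝ)..s, α x * E s x i j := by
    rw [← integral_sum_sum_mul' c hout]
    refine intervalIntegral.integral_congr fun s _ => ?_
    show α s * (∫ x in (0:ℝ)..s, α x * ∑ i, ∑ j, c i j * E s x i j)
      = ∑ i, ∑ j, c i j * (α s * ∫ x in (0:ℝ)..s, α x * E s x i j)
    rw [hinner s, Finset.mul_sum]
    refine Finset.sum_congr rfl fun i _ => ?_
    rw [Finset.mul_sum]
    refine Finset.sum_congr rfl fun j _ => ?_
    ring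
  simp only [qsResp]
  rw [houter, Finset.mul_sum]
  refine Finset.sum_congr rfl fun i _ => ?_
  rw [Finset.mul_sum]
  refine Finset.sum_congr rfl fun j _ => ?_
  ring

/-- Continuity of a linear functional of the kernel. -/
theorem continuous_qsKernel_coeff (T : ℝ) (B : Matrix (Fin 3) (Fin 3) ℝ) (c : Fin 3 → Fin 3 → ℝ) :
    Continuous fun p : ℝ × ℝ => ∑ i, ∑ j, c i j * (NormedSpace.exp (-(T * (p.1 - p.2)) • B)) i j :=
  continuous_finsetSum _ fun i _ => continuous_finsetSum _ fun j _ =>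
    continuous_const.mul (continuous_qsKernel_apply T B i j)

/-- **Monotone kernel integration for a linear functional**: `Σ c_ij e^{−uB}_ij ≤ g(u)` for `u ≥ 0` (`g` continuous) gives
`Σ c_ij f_T(B)_ij ≤ T∫∫ a a g(T(s−x))` (`T ≥ 0`, weights `a ≥ 0`). [folklore] -/
theorem sum_sum_mul_qsResp_coeff_le {ρ T : ℝ} (hT : 0 ≤ T) {B : Matrix (Fin 3) (Fin 3) ℝ} (c : Fin 3 → Fin 3 → ℝ)
    {g : ℝ → ℝ} (hg : Continuous g)
    (hle : ∀ u : ℝ, 0 ≤ u → ∑ i, ∑ j, c i j * (NormedSpace.exp (-(u • B))) i j ≤ g u) :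
    ∑ i, ∑ j, c i j * qsResp ρ T B i j ≤
      T * ∫ s in (0:ℝ)..1, LatticeShear.LatticeWord.trapezoid 0 1 ρ s *
        ∫ x in (0:ℝ)..s, LatticeShear.LatticeWord.trapezoid 0 1 ρ x * g (T * (s - x)) := by
  rw [sum_sum_mul_qsResp_coeff]
  refine mul_le_mul_of_nonneg_left ?_ hT
  have hsc : Continuous fun p : ℝ × ℝ => g (T * (p.1 - p.2)) := hg.comp (by fun_prop)
  refine intervalIntegral.integral_mono_on zero_le_one ?_ ?_ fun s hs => ?_
  · have hf : Continuous (Function.uncurry fun s x : ℝ => LatticeShear.LatticeWord.trapezoid 0 1 ρ x *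
        ∑ i, ∑ j, c i j * (NormedSpace.exp (-(T * (s - x)) • B)) i j) :=
      ((continuous_trapezoid_unit ρ).comp continuous_snd).mul (continuous_qsKernel_coeff T B c)
    exact ((continuous_trapezoid_unit ρ).mul
      (intervalIntegral.continuous_parametric_intervalIntegral_of_continuous (a₀ := 0) hf
        continuous_id)).intervalIntegrable _ _
  · have hf : Continuous (Function.uncurry fun s x : ℝ => LatticeShear.LatticeWord.trapezoid 0 1 ρ x *
        g (T * (s - x))) :=
      ((continuous_trapezoid_unit ρ).comp continuous_snd).mul hsc
    exact ((continuous_trapezoid_unit ρ).mul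
      (intervalIntegral.continuous_parametric_intervalIntegral_of_continuous (a₀ := 0) hf
        continuous_id)).intervalIntegrable _ _
  · refine mul_le_mul_of_nonneg_left ?_ (trapezoid_unit_nonneg ρ s)
    refine intervalIntegral.integral_mono_on hs.1 ?_ ?_ fun x hx => ?_
    · exact ((continuous_trapezoid_unit ρ).mul
        ((continuous_qsKernel_coeff T B c).comp (continuous_const.prodMk continuous_id))).intervalIntegrable _ _
    · exact ((continuous_trapezoid_unit ρ).mul
        (hsc.comp (continuous_const.prodMk continuous_id))).intervalIntegrable _ _
    · refine mul_le_mul_of_nonneg_left ?_ (trapezoid_unit_nonneg ρ x)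
      have hu : 0 ≤ T * (s - x) := mul_nonneg hT (by linarith [hx.2])
      have h := hle (T * (s - x)) hu
      rw [neg_smul]
      exact h

/-- The skew form `xᵀMz − zᵀMx` as a linear functional of `M` with coefficients `xᵢzⱼ − zᵢxⱼ`. -/
theorem skewForm_eq_sum_sum (M : Matrix (Fin 3) (Fin 3) ℝ) (x z : Fin 3 → ℝ) :
    x ⬝ᵥ M *ᵥ z - z ⬝ᵥ M *ᵥ x = ∑ i, ∑ j, (x i * z j - z i * x j) * M i j := by
  rw [← sum_sum_eq_form, ← sum_sum_eq_form, ← Finset.sum_sub_distrib]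
  refine Finset.sum_congr rfl fun i _ => ?_
  rw [← Finset.sum_sub_distrib]
  refine Finset.sum_congr rfl fun j _ => ?_
  ring

/-- The moment kernel with a constant: `T∫∫ a a (k · T(s−x) e^{−T(s−x)lo}) = k · g_T(lo)`. -/
theorem kernel_moment_const_eq (ρ T lo k : ℝ) :
    T * ∫ s in (0:ℝ)..1, LatticeShear.LatticeWord.trapezoid 0 1 ρ s *
      ∫ x in (0:ℝ)..s, LatticeShear.LatticeWord.trapezoid 0 1 ρ x * (k * ((T * (s - x)) * Real.exp (-(T * (s - x)) * lo))) =
      k * qsRespMoment ρ T lo := by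
  unfold qsRespMoment
  have hinner : ∀ s, ∫ x in (0:ℝ)..s, LatticeShear.LatticeWord.trapezoid 0 1 ρ x *
      (k * ((T * (s - x)) * Real.exp (-(T * (s - x)) * lo))) =
      k * ∫ x in (0:ℝ)..s, LatticeShear.LatticeWord.trapezoid 0 1 ρ x * ((T * (s - x)) * Real.exp (-(T * (s - x)) * lo)) := by
    intro s
    rw [← intervalIntegral.integral_const_mul]
    refine intervalIntegral.integral_congr fun x _ => ?_
    ring
  simp_rw [hinner]
  have houter : ∫ s in (0:ℝ)..1, LatticeShear.LatticeWord.trapezoid 0 1 ρ s *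
      (k * ∫ x in (0:ℝ)..s, LatticeShear.LatticeWord.trapezoid 0 1 ρ x * ((T * (s - x)) * Real.exp (-(T * (s - x)) * lo))) =
      k * ∫ s in (0:ℝ)..1, LatticeShear.LatticeWord.trapezoid 0 1 ρ s *
        ∫ x in (0:ℝ)..s, LatticeShear.LatticeWord.trapezoid 0 1 ρ x * ((T * (s - x)) * Real.exp (-(T * (s - x)) * lo)) := by
    rw [← intervalIntegral.integral_const_mul]
    refine intervalIntegral.integral_congr fun s _ => ?_
    ring
  rw [houter]; ring

/-- **Pointwise skew bound for the semigroup of a sectorial block**: for `u ≥ 0`,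
`xᵀe^{−uB}z − zᵀe^{−uB}x ≤ τ·hi·u·e^{−lo u}·(|x|² + |z|²)/2`  (the symmetric semigroup `e^{−uH}` has no skew part; the Duhamel
defect has operator norm `≤ (τhi/2)u e^{−lo u}` by `duhamel_defect_sq_le_one`; AM–GM on `|x||z|`). [folklore] -/
theorem skewForm_exp_le {B : Matrix (Fin 3) (Fin 3) ℝ} {τ lo hi : ℝ} (hτ : 0 ≤ τ) (hlo : 0 < lo)
    (hsec : ∀ x z : Fin 3 → ℝ, (x ⬝ᵥ B *ᵥ z - z ⬝ᵥ B *ᵥ x) ^ 2 ≤ τ ^ 2 * ((x ⬝ᵥ B *ᵥ x) * (z ⬝ᵥ B *ᵥ z)))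
    (hwin : ∀ x : Fin 3 → ℝ, lo * (x ⬝ᵥ x) ≤ x ⬝ᵥ B *ᵥ x ∧ x ⬝ᵥ B *ᵥ x ≤ hi * (x ⬝ᵥ x)) (x z : Fin 3 → ℝ) {u : ℝ} (hu : 0 ≤ u) :
    x ⬝ᵥ (NormedSpace.exp (-(u • B))) *ᵥ z - z ⬝ᵥ (NormedSpace.exp (-(u • B))) *ᵥ x ≤
      τ * hi * u * Real.exp (-(lo * u)) * ((x ⬝ᵥ x + z ⬝ᵥ z) / 2) := by
  set E := NormedSpace.exp (-(u • B)) with hEdef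
  set EH := NormedSpace.exp (-(u • symPart B)) with hEH
  have hhi : 0 ≤ hi := hlo.le.trans (lo_le_hi_of_window hwin)
  have hEHsymm : EH.IsSymm := by
    rw [hEH]
    exact (Matrix.IsSymm.smul (symPart_isSymm B) u).neg.exp
  -- the symmetric semigroup has no skew part
  have hsym0 : x ⬝ᵥ EH *ᵥ z = z ⬝ᵥ EH *ᵥ x := by
    rw [form_comm_transpose EH z x]
    unfold Matrix.IsSymm at hEHsymm
    rw [hEHsymm]
  -- the defect bound, for z and for x
  set C := τ * hi / 2 * u * Real.exp (-(lo * u)) with hC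
  have hC0 : 0 ≤ C := by rw [hC]; positivity
  have hdef : ∀ v : Fin 3 → ℝ, ∑ i, (E *ᵥ v - EH *ᵥ v) i ^ 2 ≤ C ^ 2 * ∑ i, v i ^ 2 := by
    intro v
    have h := duhamel_defect_sq_le_one hτ hlo.le hhi hsec hwin v hu
    have he2 : Real.exp (-(lo * u)) ^ 2 = Real.exp (-(2 * lo * u)) := by
      rw [sq, ← Real.exp_add]; congr 1; ring
    calc ∑ i, (E *ᵥ v - EH *ᵥ v) i ^ 2 ≤ (τ * hi / 2) ^ 2 * u ^ 2 * Real.exp (-(2 * lo * u)) * ∑ i, v i ^ 2 := h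
      _ = C ^ 2 * ∑ i, v i ^ 2 := by rw [hC, mul_pow, mul_pow, he2]
  -- Cauchy–Schwarz: |x ⬝ (E z − EH z)| ≤ C |x||z|, squared form
  have hcs : ∀ p q : Fin 3 → ℝ, (p ⬝ᵥ (E *ᵥ q - EH *ᵥ q)) ^ 2 ≤ C ^ 2 * ((p ⬝ᵥ p) * (q ⬝ᵥ q)) := by
    intro p q
    have h1 := Finset.sum_mul_sq_le_sq_mul_sq Finset.univ p (E *ᵥ q - EH *ᵥ q)
    have hp : 0 ≤ ∑ i, p i ^ 2 := Finset.sum_nonneg fun i _ => sq_nonneg _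
    rw [dotProduct, self_dotProduct_eq_sum_sq, self_dotProduct_eq_sum_sq]
    calc (∑ i, p i * (E *ᵥ q - EH *ᵥ q) i) ^ 2 ≤ (∑ i, p i ^ 2) * ∑ i, (E *ᵥ q - EH *ᵥ q) i ^ 2 := h1
      _ ≤ (∑ i, p i ^ 2) * (C ^ 2 * ∑ i, q i ^ 2) := mul_le_mul_of_nonneg_left (hdef q) hp
      _ = C ^ 2 * ((∑ i, p i ^ 2) * ∑ i, q i ^ 2) := by ring
  -- decompose the skew form
  have hdec : x ⬝ᵥ E *ᵥ z - z ⬝ᵥ E *ᵥ x = x ⬝ᵥ (E *ᵥ z - EH *ᵥ z) - z ⬝ᵥ (E *ᵥ x - EH *ᵥ x) := by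
    rw [dotProduct_sub, dotProduct_sub, hsym0]; ring
  rw [hdec]
  have hx0 : 0 ≤ x ⬝ᵥ x := by rw [self_dotProduct_eq_sum_sq]; exact Finset.sum_nonneg fun i _ => sq_nonneg _
  have hz0 : 0 ≤ z ⬝ᵥ z := by rw [self_dotProduct_eq_sum_sq]; exact Finset.sum_nonneg fun i _ => sq_nonneg _
  have h1 := hcs x z
  have h2 := hcs z x
  -- |a| ≤ C√(xx zz) ≤ C (xx+zz)/2 ; use squares: a ≤ C (xx + zz)/2 since a² ≤ C² xx zz ≤ (C (xx+zz)/2)²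
  have hb1 : x ⬝ᵥ (E *ᵥ z - EH *ᵥ z) ≤ C * ((x ⬝ᵥ x + z ⬝ᵥ z) / 2) := by
    have hsq : (x ⬝ᵥ (E *ᵥ z - EH *ᵥ z)) ^ 2 ≤ (C * ((x ⬝ᵥ x + z ⬝ᵥ z) / 2)) ^ 2 :=
      calc (x ⬝ᵥ (E *ᵥ z - EH *ᵥ z)) ^ 2 ≤ C ^ 2 * ((x ⬝ᵥ x) * (z ⬝ᵥ z)) := h1
        _ ≤ C ^ 2 * ((x ⬝ᵥ x + z ⬝ᵥ z) / 2) ^ 2 :=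
          mul_le_mul_of_nonneg_left (by nlinarith [sq_nonneg (x ⬝ᵥ x - z ⬝ᵥ z)]) (sq_nonneg C)
        _ = (C * ((x ⬝ᵥ x + z ⬝ᵥ z) / 2)) ^ 2 := by ring
    exact (abs_le_of_sq_le_sq' hsq (by positivity)).2
  have hb2 : -(C * ((x ⬝ᵥ x + z ⬝ᵥ z) / 2)) ≤ z ⬝ᵥ (E *ᵥ x - EH *ᵥ x) := by
    have hsq : (z ⬝ᵥ (E *ᵥ x - EH *ᵥ x)) ^ 2 ≤ (C * ((x ⬝ᵥ x + z ⬝ᵥ z) / 2)) ^ 2 :=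
      calc (z ⬝ᵥ (E *ᵥ x - EH *ᵥ x)) ^ 2 ≤ C ^ 2 * ((z ⬝ᵥ z) * (x ⬝ᵥ x)) := h2
        _ ≤ C ^ 2 * ((x ⬝ᵥ x + z ⬝ᵥ z) / 2) ^ 2 :=
          mul_le_mul_of_nonneg_left (by nlinarith [sq_nonneg (x ⬝ᵥ x - z ⬝ᵥ z)]) (sq_nonneg C)
        _ = (C * ((x ⬝ᵥ x + z ⬝ᵥ z) / 2)) ^ 2 := by ring
    exact (abs_le_of_sq_le_sq' hsq (by positivity)).1
  have hCC : C * ((x ⬝ᵥ x + z ⬝ᵥ z) / 2) + C * ((x ⬝ᵥ x + z ⬝ᵥ z) / 2) =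
      τ * hi * u * Real.exp (-(lo * u)) * ((x ⬝ᵥ x + z ⬝ᵥ z) / 2) := by rw [hC]; ring
  linarith

/-- **The skew part of the quasi-static response of a sectorial block** (`T ≥ 0`):
`xᵀf_T(B)z − zᵀf_T(B)x ≤ τ·hi·g_T(lo)·(|x|² + |z|²)/2`. [folklore] -/
theorem skewForm_qsResp_le {ρ T : ℝ} (hT : 0 ≤ T) {B : Matrix (Fin 3) (Fin 3) ℝ} {τ lo hi : ℝ} (hτ : 0 ≤ τ) (hlo : 0 < lo)
    (hsec : ∀ x z : Fin 3 → ℝ, (x ⬝ᵥ B *ᵥ z - z ⬝ᵥ B *ᵥ x) ^ 2 ≤ τ ^ 2 * ((x ⬝ᵥ B *ᵥ x) * (z ⬝ᵥ B *ᵥ z)))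
    (hwin : ∀ x : Fin 3 → ℝ, lo * (x ⬝ᵥ x) ≤ x ⬝ᵥ B *ᵥ x ∧ x ⬝ᵥ B *ᵥ x ≤ hi * (x ⬝ᵥ x)) (x z : Fin 3 → ℝ) :
    x ⬝ᵥ (qsResp ρ T B) *ᵥ z - z ⬝ᵥ (qsResp ρ T B) *ᵥ x ≤
      τ * hi * qsRespMoment ρ T lo * ((x ⬝ᵥ x + z ⬝ᵥ z) / 2) := by
  rw [skewForm_eq_sum_sum]
  set k := τ * hi * ((x ⬝ᵥ x + z ⬝ᵥ z) / 2) with hk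
  have hg : Continuous fun u : ℝ => k * (u * Real.exp (-u * lo)) := by fun_prop
  have hle : ∀ u : ℝ, 0 ≤ u → ∑ i, ∑ j, (x i * z j - z i * x j) * (NormedSpace.exp (-(u • B))) i j ≤
      k * (u * Real.exp (-u * lo)) := by
    intro u hu
    have h := skewForm_exp_le hτ hlo hsec hwin x z hu
    rw [skewForm_eq_sum_sum] at h
    have he : Real.exp (-u * lo) = Real.exp (-(lo * u)) := by congr 1; ring
    rw [he, hk]
    linarith
  have h := sum_sum_mul_qsResp_coeff_le (ρ := ρ) (B := B) hT (fun i j => x i * z j - z i * x j) hg hle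
  have hid : T * ∫ s in (0:ℝ)..1, LatticeShear.LatticeWord.trapezoid 0 1 ρ s *
      ∫ x in (0:ℝ)..s, LatticeShear.LatticeWord.trapezoid 0 1 ρ x *
        (k * ((T * (s - x)) * Real.exp (-(T * (s - x)) * lo))) = k * qsRespMoment ρ T lo :=
    kernel_moment_const_eq ρ T lo k
  have h' : ∑ i, ∑ j, (x i * z j - z i * x j) * qsResp ρ T B i j ≤ k * qsRespMoment ρ T lo := by
    rw [← hid]
    refine h.trans (le_of_eq ?_)
    congr 1
  calc ∑ i, ∑ j, (x i * z j - z i * x j) * qsResp ρ T B i j ≤ k * qsRespMoment ρ T lo := h'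
    _ = τ * hi * qsRespMoment ρ T lo * ((x ⬝ᵥ x + z ⬝ᵥ z) / 2) := by rw [hk]; ring

/-- **THE LOSSY SECTOR OF THE SLOT RESPONSE (a proved substitute for hypothesis L1⁺).**  For `T ≥ 0`, `B` sectorial (`τ ≥ 0`, window `[lo, hi]`,
`0 < lo`), with `ylo := f_T(hi) − (τhi/2)·g_T(lo) > 0`:  `(xᵀFz − zᵀFx)² ≤ (τ·θ)²·(xᵀFx)(zᵀFz)` for `F = f_T(B)` and
`θ = hi·g_T(lo)/ylo`.  (Scaling `x ↦ λx`, `z ↦ z/λ` turns the AM–GM form of `skewForm_qsResp_le` into the product form.)  Static limit `θ → ΛV⁴/(1 − τΛV⁴/2)`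
for the window `[1/ΛV, ΛV]`; admissible (`γ(c)·θ < 1`) for `ΛV ≤ 1.03` (table in the memo, §8). [folklore] -/
theorem qsResp_sector_lossy {ρ T : ℝ} (hT : 0 ≤ T) {B : Matrix (Fin 3) (Fin 3) ℝ} {τ lo hi : ℝ} (hτ : 0 ≤ τ) (hlo : 0 < lo)
    (hsec : ∀ x z : Fin 3 → ℝ, (x ⬝ᵥ B *ᵥ z - z ⬝ᵥ B *ᵥ x) ^ 2 ≤ τ ^ 2 * ((x ⬝ᵥ B *ᵥ x) * (z ⬝ᵥ B *ᵥ z)))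
    (hwin : ∀ x : Fin 3 → ℝ, lo * (x ⬝ᵥ x) ≤ x ⬝ᵥ B *ᵥ x ∧ x ⬝ᵥ B *ᵥ x ≤ hi * (x ⬝ᵥ x))
    (hylo : 0 < qsRespScalar ρ T hi - τ * hi / 2 * qsRespMoment ρ T lo) (x z : Fin 3 → ℝ) :
    (x ⬝ᵥ (qsResp ρ T B) *ᵥ z - z ⬝ᵥ (qsResp ρ T B) *ᵥ x) ^ 2 ≤
      (τ * (hi * qsRespMoment ρ T lo / (qsRespScalar ρ T hi - τ * hi / 2 * qsRespMoment ρ T lo))) ^ 2 *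
        ((x ⬝ᵥ (qsResp ρ T B) *ᵥ x) * (z ⬝ᵥ (qsResp ρ T B) *ᵥ z)) := by
  set F := qsResp ρ T B with hF
  set g := qsRespMoment ρ T lo with hg
  set ylo := qsRespScalar ρ T hi - τ * hi / 2 * qsRespMoment ρ T lo with hylo_def
  have hLE := lowerEdgeTarget_holds ρ T hT B τ lo hi hτ hlo hsec hwin
  have hx : ylo * (x ⬝ᵥ x) ≤ x ⬝ᵥ F *ᵥ x := hLE x
  have hz : ylo * (z ⬝ᵥ z) ≤ z ⬝ᵥ F *ᵥ z := hLE z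
  have hhi : 0 ≤ hi := hlo.le.trans (lo_le_hi_of_window hwin)
  have hx0 : 0 ≤ x ⬝ᵥ x := by rw [self_dotProduct_eq_sum_sq]; exact Finset.sum_nonneg fun i _ => sq_nonneg _
  have hz0 : 0 ≤ z ⬝ᵥ z := by rw [self_dotProduct_eq_sum_sq]; exact Finset.sum_nonneg fun i _ => sq_nonneg _
  -- g ≥ 0 (moment of a nonnegative kernel): from skewForm bound at x = z? use the AM-GM bound with (x, z) ↦ (x, x): 0 ≤ τ hi g |x|²... not needed;
  -- product form of the skew bound: for every t > 0, a ≤ τ hi g (t|x|² + |z|²/t)/2, hence a² ≤ (τ hi g)² |x|²|z|².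
  have hprod : (x ⬝ᵥ F *ᵥ z - z ⬝ᵥ F *ᵥ x) ^ 2 ≤ (τ * hi * g) ^ 2 * ((x ⬝ᵥ x) * (z ⬝ᵥ z)) := by
    -- scaling: apply the AM–GM bound to (c • x, z) and (x, c • z) for all c, read off the discriminant
    have key : ∀ c : ℝ, c * (x ⬝ᵥ F *ᵥ z - z ⬝ᵥ F *ᵥ x) ≤ τ * hi * g * ((c ^ 2 * (x ⬝ᵥ x) + z ⬝ᵥ z) / 2) := by
      intro c
      have h := skewForm_qsResp_le (ρ := ρ) hT hτ hlo hsec hwin (c • x) z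
      rw [hF.symm] at h
      have e1 : (c • x) ⬝ᵥ F *ᵥ z = c * (x ⬝ᵥ F *ᵥ z) := by rw [smul_dotProduct, smul_eq_mul]
      have e2 : z ⬝ᵥ F *ᵥ (c • x) = c * (z ⬝ᵥ F *ᵥ x) := by rw [Matrix.mulVec_smul, dotProduct_smul, smul_eq_mul]
      have e3 : (c • x) ⬝ᵥ (c • x) = c ^ 2 * (x ⬝ᵥ x) := by
        rw [smul_dotProduct, dotProduct_smul, smul_eq_mul, smul_eq_mul]; ring
      rw [e1, e2, e3] at h
      linarith
    -- quadratic in c nonneg for all c ⇒ discriminant ≤ 0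
    set a := x ⬝ᵥ F *ᵥ z - z ⬝ᵥ F *ᵥ x with ha
    set m := τ * hi * g with hm
    have hsum : 0 ≤ m * ((x ⬝ᵥ x + z ⬝ᵥ z) / 2) := by
      have h1 := key 1
      have h2 := key (-1)
      norm_num at h1 h2
      linarith
    -- For all c: (m xx/2) c² − a c + m zz/2 ≥ 0.
    by_cases hxx : x ⬝ᵥ x = 0
    · -- then a = 0: from key with c → ±large
      have h1 : ∀ c : ℝ, c * a ≤ m * (z ⬝ᵥ z) / 2 := by
        intro c; have h := key c; rw [hxx, mul_zero, zero_add] at h; linarith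
      have ha0 : a = 0 := by
        by_contra hne
        have hpos : 0 < a ^ 2 := by positivity
        have h3 := h1 ((m * (z ⬝ᵥ z) / 2 + 1) / a)
        rw [div_mul_cancel₀ _ hne] at h3
        linarith
      rw [ha0, hxx]; simp
    · have hxpos : 0 < x ⬝ᵥ x := lt_of_le_of_ne hx0 (Ne.symm hxx)
      by_cases hm' : m = 0
      · have h1 : ∀ c : ℝ, c * a ≤ 0 := by intro c; have := key c; rw [hm'] at this; simpa using this
        have ha0 : a = 0 := by
          have h2 := h1 a; have h3 := h1 (-a); nlinarith
        rw [ha0, hm']; simp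
      · have hmnn : 0 ≤ m := by
          by_contra hmn
          push_neg at hmn
          have : m * ((x ⬝ᵥ x + z ⬝ᵥ z) / 2) < 0 := mul_neg_of_neg_of_pos hmn (by linarith)
          linarith
        have hmpos : 0 < m := lt_of_le_of_ne hmnn (Ne.symm hm')
        -- choose c = a / (m xx)
        have h := key (a / (m * (x ⬝ᵥ x)))
        have hmx : 0 < m * (x ⬝ᵥ x) := mul_pos hmpos hxpos
        have e : a / (m * (x ⬝ᵥ x)) * a = a ^ 2 / (m * (x ⬝ᵥ x)) := by rw [div_mul_eq_mul_div, sq]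
        rw [e] at h
        have e2 : (a / (m * (x ⬝ᵥ x))) ^ 2 * (x ⬝ᵥ x) = a ^ 2 / (m ^ 2 * (x ⬝ᵥ x)) := by
          field_simp
        rw [e2] at h
        -- h : a²/(m xx) ≤ m (a²/(m² xx) + zz)/2 = a²/(2 m xx) + m zz/2 ⇒ a²/(2 m xx) ≤ m zz/2 ⇒ a² ≤ m² xx zz
        have h3 : a ^ 2 / (m * (x ⬝ᵥ x)) ≤ m * (z ⬝ᵥ z) := by
          have : m * ((a ^ 2 / (m ^ 2 * (x ⬝ᵥ x)) + z ⬝ᵥ z) / 2) = a ^ 2 / (m * (x ⬝ᵥ x)) / 2 + m * (z ⬝ᵥ z) / 2 := by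
            field_simp
          rw [this] at h
          linarith
        rw [div_le_iff₀ hmx] at h3
        nlinarith
  -- convert |x|²|z|² into the forms via the lower window
  have hxF : x ⬝ᵥ x ≤ (x ⬝ᵥ F *ᵥ x) / ylo := by rw [le_div_iff₀ hylo]; linarith
  have hzF : z ⬝ᵥ z ≤ (z ⬝ᵥ F *ᵥ z) / ylo := by rw [le_div_iff₀ hylo]; linarith
  have hFx0 : 0 ≤ x ⬝ᵥ F *ᵥ x := le_trans (mul_nonneg hylo.le hx0) hx
  have hFz0 : 0 ≤ z ⬝ᵥ F *ᵥ z := le_trans (mul_nonneg hylo.le hz0) hz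
  calc (x ⬝ᵥ F *ᵥ z - z ⬝ᵥ F *ᵥ x) ^ 2 ≤ (τ * hi * g) ^ 2 * ((x ⬝ᵥ x) * (z ⬝ᵥ z)) := hprod
    _ ≤ (τ * hi * g) ^ 2 * (((x ⬝ᵥ F *ᵥ x) / ylo) * ((z ⬝ᵥ F *ᵥ z) / ylo)) :=
        mul_le_mul_of_nonneg_left (mul_le_mul hxF hzF hz0 (div_nonneg hFx0 hylo.le)) (sq_nonneg _)
    _ = (τ * (hi * g / ylo)) ^ 2 * ((x ⬝ᵥ F *ᵥ x) * (z ⬝ᵥ F *ᵥ z)) := by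
        field_simp

/-- **TYPED + PROVED: the lossy sector of the slot response** (substitute for hypothesis L1⁺ of p644915 / p650822 / §4: feed
`oddSectorial_excQS_strict_of_slotWindows` with `τ·θ` in place of `τ` — the sector inequality is congruence-invariant, so it transports to
`slotQ = m·PᵀF P`; the odd contraction becomes `κ = γ(c)·θ`). -/
def LossySectorTarget (ρ : ℝ) : Prop :=
  ∀ T : ℝ, 0 ≤ T → ∀ (B : Matrix (Fin 3) (Fin 3) ℝ) (τ lo hi : ℝ), 0 ≤ τ → 0 < lo →
    (∀ x z : Fin 3 → ℝ, (x ⬝ᵥ B *ᵥ z - z ⬝ᵥ B *ᵥ x) ^ 2 ≤ τ ^ 2 * ((x ⬝ᵥ B *ᵥ x) * (z ⬝ᵥ B *ᵥ z))) →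
    (∀ x : Fin 3 → ℝ, lo * (x ⬝ᵥ x) ≤ x ⬝ᵥ B *ᵥ x ∧ x ⬝ᵥ B *ᵥ x ≤ hi * (x ⬝ᵥ x)) →
    0 < qsRespScalar ρ T hi - τ * hi / 2 * qsRespMoment ρ T lo →
    ∀ x z : Fin 3 → ℝ,
      (x ⬝ᵥ (qsResp ρ T B) *ᵥ z - z ⬝ᵥ (qsResp ρ T B) *ᵥ x) ^ 2 ≤
        (τ * (hi * qsRespMoment ρ T lo / (qsRespScalar ρ T hi - τ * hi / 2 * qsRespMoment ρ T lo))) ^ 2 *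
          ((x ⬝ᵥ (qsResp ρ T B) *ᵥ x) * (z ⬝ᵥ (qsResp ρ T B) *ᵥ z))

/-- **PROVED.** -/
theorem lossySectorTarget_holds (ρ : ℝ) : LossySectorTarget ρ :=
  fun T hT B τ lo hi hτ hlo hsec hwin hylo x z => qsResp_sector_lossy (ρ := ρ) hT hτ hlo hsec hwin hylo x z

end LossySector


/-! ## §9 TOWARDS THE EXACT SECTOR NON-EXPANSION L1⁺ (branch B): the resolvent ATOMS are sector-safe (PROVED, five lines), and
L1⁺ follows from ONE typed analytic identity — the cosine (Bochner) mixture `f_T(B) = (T/π)∫₀^∞ Â_ρ(ξ)·(TB)((TB)²+ξ²)⁻¹ dξ`, `Â_ρ ≥ 0`. -/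

section SectorAtoms

open Literature.Analysis Literature.Analysis.FunctionSpaces Literature.Analysis.FluidPDE
open Literature.Analysis.FluidPDE.LatticeShear

theorem dotProduct_self_nonneg' (x : Fin 3 → ℝ) : 0 ≤ x ⬝ᵥ x := by
  rw [self_dotProduct_eq_sum_sq]; exact Finset.sum_nonneg fun i _ => sq_nonneg _

/-- Discriminant form of a sector inequality: `c·a ≤ m(c²X + Z)/2` for every real `c` (`X, Z ≥ 0`) forces `a² ≤ m²XZ`. -/
theorem sq_le_of_forall_scale {a m X Z : ℝ} (hX : 0 ≤ X) (hZ : 0 ≤ Z)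
    (key : ∀ c : ℝ, c * a ≤ m * ((c ^ 2 * X + Z) / 2)) : a ^ 2 ≤ m ^ 2 * (X * Z) := by
  have hsum : 0 ≤ m * ((X + Z) / 2) := by
    have h1 := key 1
    have h2 := key (-1)
    norm_num at h1 h2
    linarith
  by_cases hxx : X = 0
  · have h1 : ∀ c : ℝ, c * a ≤ m * Z / 2 := by
      intro c; have h := key c; rw [hxx, mul_zero, zero_add] at h; linarith
    have ha0 : a = 0 := by
      by_contra hne
      have hpos : 0 < a ^ 2 := by positivity
      have h3 := h1 ((m * Z / 2 + 1) / a)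
      rw [div_mul_cancel₀ _ hne] at h3
      linarith
    rw [ha0, hxx]; simp
  · have hxpos : 0 < X := lt_of_le_of_ne hX (Ne.symm hxx)
    by_cases hm' : m = 0
    · have h1 : ∀ c : ℝ, c * a ≤ 0 := by intro c; have := key c; rw [hm'] at this; simpa using this
      have ha0 : a = 0 := by
        have h2 := h1 a; have h3 := h1 (-a); nlinarith
      rw [ha0, hm']; simp
    · have hmnn : 0 ≤ m := by
        by_contra hmn
        push_neg at hmn
        have : m * ((X + Z) / 2) < 0 := mul_neg_of_neg_of_pos hmn (by linarith)
        linarith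
      have hmpos : 0 < m := lt_of_le_of_ne hmnn (Ne.symm hm')
      have h := key (a / (m * X))
      have hmx : 0 < m * X := mul_pos hmpos hxpos
      have e : a / (m * X) * a = a ^ 2 / (m * X) := by rw [div_mul_eq_mul_div, sq]
      rw [e] at h
      have e2 : (a / (m * X)) ^ 2 * X = a ^ 2 / (m ^ 2 * X) := by field_simp
      rw [e2] at h
      have h3 : a ^ 2 / (m * X) ≤ m * Z := by
        have : m * ((a ^ 2 / (m ^ 2 * X) + Z) / 2) = a ^ 2 / (m * X) / 2 + m * Z / 2 := by field_simp
        rw [this] at h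
        linarith
      rw [div_le_iff₀ hmx] at h3
      nlinarith

/-- The elementary sum rule behind the atom lemma: `α² ≤ τ²ab`, `β² ≤ τ²cd`, `a, b, c, d ≥ 0` give `(α + β)² ≤ τ²(a + c)(b + d)`. -/
theorem sq_add_le_of_sq_le {α β τ a b c d : ℝ} (ha : 0 ≤ a) (hb : 0 ≤ b) (hc : 0 ≤ c) (hd : 0 ≤ d)
    (h₁ : α ^ 2 ≤ τ ^ 2 * (a * b)) (h₂ : β ^ 2 ≤ τ ^ 2 * (c * d)) :
    (α + β) ^ 2 ≤ τ ^ 2 * ((a + c) * (b + d)) := by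
  -- 2αβ ≤ τ²(ad + bc):  (2αβ)² = 4α²β² ≤ 4τ⁴abcd ≤ τ⁴(ad + bc)²
  have hcross : 2 * (α * β) ≤ τ ^ 2 * (a * d + b * c) := by
    have hsq : (2 * (α * β)) ^ 2 ≤ (τ ^ 2 * (a * d + b * c)) ^ 2 := by
      have hab : α ^ 2 * β ^ 2 ≤ τ ^ 2 * (a * b) * (τ ^ 2 * (c * d)) :=
        mul_le_mul h₁ h₂ (sq_nonneg _) (by positivity)
      have e1 : (2 * (α * β)) ^ 2 = 4 * (α ^ 2 * β ^ 2) := by ring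
      have e2 : (τ ^ 2 * (a * d + b * c)) ^ 2 = (τ ^ 2 * (a * d - b * c)) ^ 2 + 4 * (τ ^ 2 * (a * b) * (τ ^ 2 * (c * d))) := by
        ring
      rw [e1, e2]
      nlinarith [sq_nonneg (τ ^ 2 * (a * d - b * c))]
    exact (abs_le_of_sq_le_sq' hsq (by positivity)).2
  nlinarith

/-- **THE ATOM LEMMA (pre-image form).**  If `C` is sectorial (`(xᵀCz − zᵀCx)² ≤ τ²(xᵀCx)(zᵀCz)`) and accretive, then for `s ≥ 0` the "resolvent atom"
`R = C(C² + s)⁻¹` is sectorial with the SAME `τ`: writing `x = (C² + s)p`, `z = (C² + s)q` (so `Rx = Cp`, `Rz = Cq`), the sector inequality for `R` at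
`(x, z)` is `(xᵀCq − zᵀCp)² ≤ τ²(xᵀCp)(zᵀCq)`, and with `u = Cp`, `v = Cq` one has `xᵀCq = vᵀCu + s·pᵀCq` etc., so it is the sum rule
`sq_add_le_of_sq_le` applied to the sector inequalities at `(u, v)` and at `(p, q)`.  (Complex form: `⟨Rw, w⟩ = conj⟨Bu, u⟩ + s⟨Bv, v⟩ ∈ S_θ`.) [folklore] -/
theorem sector_atom_pre {C : Matrix (Fin 3) (Fin 3) ℝ} {τ s : ℝ} (hs : 0 ≤ s)
    (hsec : ∀ x z : Fin 3 → ℝ, (x ⬝ᵥ C *ᵥ z - z ⬝ᵥ C *ᵥ x) ^ 2 ≤ τ ^ 2 * ((x ⬝ᵥ C *ᵥ x) * (z ⬝ᵥ C *ᵥ z)))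
    (hpos : ∀ x : Fin 3 → ℝ, 0 ≤ x ⬝ᵥ C *ᵥ x) (p q : Fin 3 → ℝ) :
    ((C *ᵥ (C *ᵥ p) + s • p) ⬝ᵥ (C *ᵥ q) - (C *ᵥ (C *ᵥ q) + s • q) ⬝ᵥ (C *ᵥ p)) ^ 2 ≤
      τ ^ 2 * (((C *ᵥ (C *ᵥ p) + s • p) ⬝ᵥ (C *ᵥ p)) * ((C *ᵥ (C *ᵥ q) + s • q) ⬝ᵥ (C *ᵥ q))) ∧
    0 ≤ (C *ᵥ (C *ᵥ p) + s • p) ⬝ᵥ (C *ᵥ p) := by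
  set u := C *ᵥ p with hu
  set v := C *ᵥ q with hv
  have e1 : (C *ᵥ u + s • p) ⬝ᵥ v = v ⬝ᵥ C *ᵥ u + s * (p ⬝ᵥ C *ᵥ q) := by
    rw [add_dotProduct, smul_dotProduct, smul_eq_mul, dotProduct_comm (C *ᵥ u) v, hv]
  have e2 : (C *ᵥ v + s • q) ⬝ᵥ u = u ⬝ᵥ C *ᵥ v + s * (q ⬝ᵥ C *ᵥ p) := by
    rw [add_dotProduct, smul_dotProduct, smul_eq_mul, dotProduct_comm (C *ᵥ v) u, hu]
  have e3 : (C *ᵥ u + s • p) ⬝ᵥ u = u ⬝ᵥ C *ᵥ u + s * (p ⬝ᵥ C *ᵥ p) := by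
    rw [add_dotProduct, smul_dotProduct, smul_eq_mul, dotProduct_comm (C *ᵥ u) u, hu]
  have e4 : (C *ᵥ v + s • q) ⬝ᵥ v = v ⬝ᵥ C *ᵥ v + s * (q ⬝ᵥ C *ᵥ q) := by
    rw [add_dotProduct, smul_dotProduct, smul_eq_mul, dotProduct_comm (C *ᵥ v) v, hv]
  rw [e1, e2, e3, e4]
  refine ⟨?_, add_nonneg (hpos u) (mul_nonneg hs (hpos p))⟩
  have hα : (v ⬝ᵥ C *ᵥ u - u ⬝ᵥ C *ᵥ v) ^ 2 ≤ τ ^ 2 * ((u ⬝ᵥ C *ᵥ u) * (v ⬝ᵥ C *ᵥ v)) := by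
    have h := hsec u v
    have e : (v ⬝ᵥ C *ᵥ u - u ⬝ᵥ C *ᵥ v) ^ 2 = (u ⬝ᵥ C *ᵥ v - v ⬝ᵥ C *ᵥ u) ^ 2 := by ring
    rw [e]; exact h
  have hβ : (s * (p ⬝ᵥ C *ᵥ q) - s * (q ⬝ᵥ C *ᵥ p)) ^ 2 ≤ τ ^ 2 * ((s * (p ⬝ᵥ C *ᵥ p)) * (s * (q ⬝ᵥ C *ᵥ q))) := by
    have h := hsec p q
    have e : (s * (p ⬝ᵥ C *ᵥ q) - s * (q ⬝ᵥ C *ᵥ p)) ^ 2 = s ^ 2 * (p ⬝ᵥ C *ᵥ q - q ⬝ᵥ C *ᵥ p) ^ 2 := by ring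
    rw [e]
    calc s ^ 2 * (p ⬝ᵥ C *ᵥ q - q ⬝ᵥ C *ᵥ p) ^ 2 ≤ s ^ 2 * (τ ^ 2 * ((p ⬝ᵥ C *ᵥ p) * (q ⬝ᵥ C *ᵥ q))) :=
          mul_le_mul_of_nonneg_left h (sq_nonneg s)
      _ = τ ^ 2 * ((s * (p ⬝ᵥ C *ᵥ p)) * (s * (q ⬝ᵥ C *ᵥ q))) := by ring
  have h := sq_add_le_of_sq_le (hpos u) (hpos v) (mul_nonneg hs (hpos p)) (mul_nonneg hs (hpos q)) hα hβ
  have e : v ⬝ᵥ C *ᵥ u + s * (p ⬝ᵥ C *ᵥ q) - (u ⬝ᵥ C *ᵥ v + s * (q ⬝ᵥ C *ᵥ p)) =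
      (v ⬝ᵥ C *ᵥ u - u ⬝ᵥ C *ᵥ v) + (s * (p ⬝ᵥ C *ᵥ q) - s * (q ⬝ᵥ C *ᵥ p)) := by ring
  rw [e]; exact h

/-- `C² + s` is invertible for `s ≥ 0` when `C` is coercive (`lo|x|² ≤ xᵀCx`, `lo > 0`). -/
theorem isUnit_det_sq_add {C : Matrix (Fin 3) (Fin 3) ℝ} {lo s : ℝ} (hlo : 0 < lo) (hs : 0 ≤ s)
    (hco : ∀ x : Fin 3 → ℝ, lo * (x ⬝ᵥ x) ≤ x ⬝ᵥ C *ᵥ x) :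
    IsUnit (C * C + s • (1 : Matrix (Fin 3) (Fin 3) ℝ)).det := by
  rw [← Matrix.isUnit_iff_isUnit_det, ← Matrix.mulVec_injective_iff_isUnit]
  have hker : ∀ w : Fin 3 → ℝ, (C * C + s • (1 : Matrix (Fin 3) (Fin 3) ℝ)) *ᵥ w = 0 → w = 0 := by
    intro w hw
    have hw' : C *ᵥ (C *ᵥ w) = -(s • w) := by
      rw [Matrix.add_mulVec, Matrix.smul_mulVec, Matrix.one_mulVec, ← Matrix.mulVec_mulVec] at hw
      exact eq_neg_of_add_eq_zero_left hw
    set u := C *ᵥ w with hu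
    -- uᵀCu = uᵀ(−s w) = −s (Cw)·w = −s wᵀCw ≤ 0
    have h1 : u ⬝ᵥ C *ᵥ u = -(s * (w ⬝ᵥ C *ᵥ w)) := by
      rw [hw', dotProduct_neg, dotProduct_smul, smul_eq_mul, hu, dotProduct_comm (C *ᵥ w) w]
    have hwpos : 0 ≤ w ⬝ᵥ C *ᵥ w := le_trans (mul_nonneg hlo.le (dotProduct_self_nonneg' _)) (hco w)
    have hu0 : u ⬝ᵥ u ≤ 0 := by
      have := hco u
      have : lo * (u ⬝ᵥ u) ≤ 0 := by rw [h1] at this; nlinarith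
      have huu : 0 ≤ u ⬝ᵥ u := dotProduct_self_nonneg' u
      nlinarith
    have huz : u = 0 := dotProduct_self_eq_zero.1 (le_antisymm hu0 (dotProduct_self_nonneg' _))
    have hw0 : w ⬝ᵥ C *ᵥ w = 0 := by rw [← hu, huz, dotProduct_zero]
    have hww : lo * (w ⬝ᵥ w) ≤ 0 := by rw [← hw0]; exact hco w
    have hww' : w ⬝ᵥ w ≤ 0 := by
      have h0 : 0 ≤ w ⬝ᵥ w := dotProduct_self_nonneg' w
      nlinarith
    exact dotProduct_self_eq_zero.1 (le_antisymm hww' (dotProduct_self_nonneg' _))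
  intro w₁ w₂ h
  have : (C * C + s • (1 : Matrix (Fin 3) (Fin 3) ℝ)) *ᵥ (w₁ - w₂) = 0 := by
    rw [Matrix.mulVec_sub, h, sub_self]
  exact sub_eq_zero.1 (hker _ this)

/-- The resolvent atom `R_s(C) = C·(C² + s)⁻¹` (`= Re_ℂ (C + i√s)⁻¹ = ∫₀^∞ cos(√s·u)e^{−uC} du` for accretive `C`). -/
def resolventAtom (C : Matrix (Fin 3) (Fin 3) ℝ) (s : ℝ) : Matrix (Fin 3) (Fin 3) ℝ :=
  C * (C * C + s • (1 : Matrix (Fin 3) (Fin 3) ℝ))⁻¹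

/-- **THE ATOM LEMMA.**  For a coercive sectorial `C` (`τ`, `lo > 0`) and `s ≥ 0`, the resolvent atom `R = C(C² + s)⁻¹` is `τ`-sectorial and accretive:
`(xᵀRz − zᵀRx)² ≤ τ²(xᵀRx)(zᵀRz)`, `xᵀRx ≥ 0`. [folklore] -/
theorem sector_resolventAtom {C : Matrix (Fin 3) (Fin 3) ℝ} {τ lo s : ℝ} (hlo : 0 < lo) (hs : 0 ≤ s)
    (hsec : ∀ x z : Fin 3 → ℝ, (x ⬝ᵥ C *ᵥ z - z ⬝ᵥ C *ᵥ x) ^ 2 ≤ τ ^ 2 * ((x ⬝ᵥ C *ᵥ x) * (z ⬝ᵥ C *ᵥ z)))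
    (hco : ∀ x : Fin 3 → ℝ, lo * (x ⬝ᵥ x) ≤ x ⬝ᵥ C *ᵥ x) (x z : Fin 3 → ℝ) :
    (x ⬝ᵥ (resolventAtom C s) *ᵥ z - z ⬝ᵥ (resolventAtom C s) *ᵥ x) ^ 2 ≤
      τ ^ 2 * ((x ⬝ᵥ (resolventAtom C s) *ᵥ x) * (z ⬝ᵥ (resolventAtom C s) *ᵥ z)) ∧
    0 ≤ x ⬝ᵥ (resolventAtom C s) *ᵥ x := by
  have hpos : ∀ x : Fin 3 → ℝ, 0 ≤ x ⬝ᵥ C *ᵥ x := fun x => le_trans (mul_nonneg hlo.le (dotProduct_self_nonneg' x)) (hco x)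
  set M := C * C + s • (1 : Matrix (Fin 3) (Fin 3) ℝ) with hM
  have hdet : IsUnit M.det := isUnit_det_sq_add hlo hs hco
  set p := M⁻¹ *ᵥ x with hp
  set q := M⁻¹ *ᵥ z with hq
  have hx : x = C *ᵥ (C *ᵥ p) + s • p := by
    have : M *ᵥ p = x := by rw [hp, Matrix.mulVec_mulVec, Matrix.mul_nonsing_inv _ hdet, Matrix.one_mulVec]
    rw [← this, hM, Matrix.add_mulVec, Matrix.smul_mulVec, Matrix.one_mulVec, ← Matrix.mulVec_mulVec]
  have hz : z = C *ᵥ (C *ᵥ q) + s • q := by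
    have : M *ᵥ q = z := by rw [hq, Matrix.mulVec_mulVec, Matrix.mul_nonsing_inv _ hdet, Matrix.one_mulVec]
    rw [← this, hM, Matrix.add_mulVec, Matrix.smul_mulVec, Matrix.one_mulVec, ← Matrix.mulVec_mulVec]
  have hRz : (resolventAtom C s) *ᵥ z = C *ᵥ q := by
    unfold resolventAtom; rw [← hM, ← Matrix.mulVec_mulVec]
  have hRx : (resolventAtom C s) *ᵥ x = C *ᵥ p := by
    unfold resolventAtom; rw [← hM, ← Matrix.mulVec_mulVec]
  rw [hRz, hRx]
  have h := sector_atom_pre (C := C) hs hsec hpos p q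
  have h' := sector_atom_pre (C := C) hs hsec hpos q p
  rw [← hx, ← hz] at h
  exact ⟨h.1, h.2⟩

/-- The spectral weight of the slot kernel: `Â_ρ(ξ) = |â(ξ)|² = 16 sin²(ρξ/2) sin²((1−ρ)ξ/2)/(ρ²ξ⁴) ≥ 0` (`a = trapezoid 0 1 ρ = ρ⁻¹·𝟙_{[0,ρ]} ⋆ 𝟙_{[0,1−ρ]}`
for `0 < ρ ≤ 1/2`; its autocorrelation `A = a ⋆ ã` has Fourier transform `|â|²` — Wiener–Khinchin). -/
def slotSpec (ρ ξ : ℝ) : ℝ := 16 * Real.sin (ρ * ξ / 2) ^ 2 * Real.sin ((1 - ρ) * ξ / 2) ^ 2 / (ρ ^ 2 * ξ ^ 4)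

theorem slotSpec_nonneg (ρ ξ : ℝ) : 0 ≤ slotSpec ρ ξ := by unfold slotSpec; positivity

/-- **TYPED (the single analytic input of branch B): THE COSINE MIXTURE.**  For `0 < ρ ≤ 1/2`, `T > 0` and coercive `B`, the slot response is the
nonnegative mixture of resolvent atoms `f_T(B) = (T/π)∫₀^∞ Â_ρ(ξ)·(TB)((TB)² + ξ²)⁻¹ dξ` (weak form, with integrability).  Proof sketch (NOT typed
here, per D24-16: L-sized analysis): `f_T(B) = T∫₀¹ A(u)e^{−uTB}du`, `A(u) = (1/π)∫₀^∞ Â_ρ(ξ)cos(ξu)dξ` (Fourier inversion, Mathlib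
`Continuous.fourier_inversion`, `𝓕A = |â|²` by Fubini), Fubini, and `∫₀^∞ cos(ξu)e^{−uC}du = C(C²+ξ²)⁻¹` (FTC on `Ioi`).  Verified numerically to
`10⁻⁶` (scalar `B`, ρ ∈ {1/4, 1/2}, T ∈ [16, 100]; `odd9/cosine_repr_check.py`). -/
def CosineMixture (ρ : ℝ) : Prop :=
  ∀ T : ℝ, 0 < T → ∀ (B : Matrix (Fin 3) (Fin 3) ℝ) (lo : ℝ), 0 < lo → (∀ x : Fin 3 → ℝ, lo * (x ⬝ᵥ x) ≤ x ⬝ᵥ B *ᵥ x) →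
    ∀ x z : Fin 3 → ℝ,
      MeasureTheory.IntegrableOn (fun ξ : ℝ => slotSpec ρ ξ * (x ⬝ᵥ (resolventAtom (T • B) (ξ ^ 2)) *ᵥ z)) (Set.Ioi 0) ∧
      x ⬝ᵥ (qsResp ρ T B) *ᵥ z = T / Real.pi * ∫ ξ in Set.Ioi 0, slotSpec ρ ξ * (x ⬝ᵥ (resolventAtom (T • B) (ξ ^ 2)) *ᵥ z)

/-- **L1⁺ FROM THE COSINE MIXTURE (PROVED): exact sector NON-EXPANSION of the slot response.**  If `CosineMixture ρ` holds then for `T > 0` and every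
coercive `τ`-sectorial block `B` (`lo > 0`), `F = f_T(B)` is `τ`-sectorial: `(xᵀFz − zᵀFx)² ≤ τ²(xᵀFx)(zᵀFz)` — i.e. `θ ≤ 1`, branch B of D24-16
(`ΛV` up to `1.10`) with NO loss.  (Atoms sector-safe + nonnegative weights + the discriminant trick.) -/
theorem sectorPreservation_of_cosineMixture {ρ : ℝ} (hCM : CosineMixture ρ) {T : ℝ} (hT : 0 < T)
    {B : Matrix (Fin 3) (Fin 3) ℝ} {τ lo : ℝ} (hlo : 0 < lo)
    (hsec : ∀ x z : Fin 3 → ℝ, (x ⬝ᵥ B *ᵥ z - z ⬝ᵥ B *ᵥ x) ^ 2 ≤ τ ^ 2 * ((x ⬝ᵥ B *ᵥ x) * (z ⬝ᵥ B *ᵥ z)))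
    (hco : ∀ x : Fin 3 → ℝ, lo * (x ⬝ᵥ x) ≤ x ⬝ᵥ B *ᵥ x) (x z : Fin 3 → ℝ) :
    (x ⬝ᵥ (qsResp ρ T B) *ᵥ z - z ⬝ᵥ (qsResp ρ T B) *ᵥ x) ^ 2 ≤
      τ ^ 2 * ((x ⬝ᵥ (qsResp ρ T B) *ᵥ x) * (z ⬝ᵥ (qsResp ρ T B) *ᵥ z)) := by
  set F := qsResp ρ T B with hF
  -- the scaled block `T • B` is coercive (`T·lo`) and `τ`-sectorial
  have hcoT : ∀ x : Fin 3 → ℝ, T * lo * (x ⬝ᵥ x) ≤ x ⬝ᵥ (T • B) *ᵥ x := by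
    intro y; rw [Matrix.smul_mulVec, dotProduct_smul, smul_eq_mul, mul_assoc]
    exact mul_le_mul_of_nonneg_left (hco y) hT.le
  have hsecT : ∀ x z : Fin 3 → ℝ, (x ⬝ᵥ (T • B) *ᵥ z - z ⬝ᵥ (T • B) *ᵥ x) ^ 2 ≤
      τ ^ 2 * ((x ⬝ᵥ (T • B) *ᵥ x) * (z ⬝ᵥ (T • B) *ᵥ z)) := by
    intro y w
    simp only [Matrix.smul_mulVec, dotProduct_smul, smul_eq_mul]
    have h := hsec y w
    have e : (T * (y ⬝ᵥ B *ᵥ w) - T * (w ⬝ᵥ B *ᵥ y)) ^ 2 = T ^ 2 * (y ⬝ᵥ B *ᵥ w - w ⬝ᵥ B *ᵥ y) ^ 2 := by ring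
    rw [e]
    calc T ^ 2 * (y ⬝ᵥ B *ᵥ w - w ⬝ᵥ B *ᵥ y) ^ 2 ≤ T ^ 2 * (τ ^ 2 * ((y ⬝ᵥ B *ᵥ y) * (w ⬝ᵥ B *ᵥ w))) :=
          mul_le_mul_of_nonneg_left h (sq_nonneg T)
      _ = τ ^ 2 * (T * (y ⬝ᵥ B *ᵥ y) * (T * (w ⬝ᵥ B *ᵥ w))) := by ring
  have hTlo : 0 < T * lo := mul_pos hT hlo
  -- pointwise atom facts
  have atom : ∀ ξ : ℝ, ∀ y w : Fin 3 → ℝ,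
      (y ⬝ᵥ (resolventAtom (T • B) (ξ ^ 2)) *ᵥ w - w ⬝ᵥ (resolventAtom (T • B) (ξ ^ 2)) *ᵥ y) ^ 2 ≤
        τ ^ 2 * ((y ⬝ᵥ (resolventAtom (T • B) (ξ ^ 2)) *ᵥ y) * (w ⬝ᵥ (resolventAtom (T • B) (ξ ^ 2)) *ᵥ w)) ∧
      0 ≤ y ⬝ᵥ (resolventAtom (T • B) (ξ ^ 2)) *ᵥ y :=
    fun ξ y w => sector_resolventAtom hTlo (sq_nonneg ξ) hsecT hcoT y w
  have hTpi : 0 ≤ T / Real.pi := div_nonneg hT.le Real.pi_pos.le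
  -- abbreviations for the integrands
  set Rξ : ℝ → Matrix (Fin 3) (Fin 3) ℝ := fun ξ => resolventAtom (T • B) (ξ ^ 2) with hRξ
  -- quadratic forms of F are nonnegative
  have hQnn : ∀ y : Fin 3 → ℝ, 0 ≤ y ⬝ᵥ F *ᵥ y := by
    intro y
    rw [hF, (hCM T hT B lo hlo hco y y).2]
    refine mul_nonneg hTpi (MeasureTheory.setIntegral_nonneg measurableSet_Ioi fun ξ _ => ?_)
    exact mul_nonneg (slotSpec_nonneg ρ ξ) (atom ξ y y).2
  -- the key family of inequalities: c·σ_F(x,z) ≤ τ'(c²Q_F(x) + Q_F(z))/2 with τ' = |τ|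
  have key : ∀ c : ℝ, c * (x ⬝ᵥ F *ᵥ z - z ⬝ᵥ F *ᵥ x) ≤ |τ| * ((c ^ 2 * (x ⬝ᵥ F *ᵥ x) + z ⬝ᵥ F *ᵥ z) / 2) := by
    intro c
    have I1 := hCM T hT B lo hlo hco (c • x) z
    have I2 := hCM T hT B lo hlo hco z (c • x)
    have I3 := hCM T hT B lo hlo hco (c • x) (c • x)
    have I4 := hCM T hT B lo hlo hco z z
    rw [← hF] at I1 I2 I3 I4
    have e1 : (c • x) ⬝ᵥ F *ᵥ z = c * (x ⬝ᵥ F *ᵥ z) := by rw [smul_dotProduct, smul_eq_mul]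
    have e2 : z ⬝ᵥ F *ᵥ (c • x) = c * (z ⬝ᵥ F *ᵥ x) := by rw [Matrix.mulVec_smul, dotProduct_smul, smul_eq_mul]
    have e3 : (c • x) ⬝ᵥ F *ᵥ (c • x) = c ^ 2 * (x ⬝ᵥ F *ᵥ x) := by
      rw [Matrix.mulVec_smul, smul_dotProduct, dotProduct_smul, smul_eq_mul, smul_eq_mul]; ring
    have lhs : c * (x ⬝ᵥ F *ᵥ z - z ⬝ᵥ F *ᵥ x) = T / Real.pi *
        ∫ ξ in Set.Ioi 0, (slotSpec ρ ξ * ((c • x) ⬝ᵥ (Rξ ξ) *ᵥ z) - slotSpec ρ ξ * (z ⬝ᵥ (Rξ ξ) *ᵥ (c • x))) :=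
      calc c * (x ⬝ᵥ F *ᵥ z - z ⬝ᵥ F *ᵥ x) = (c • x) ⬝ᵥ F *ᵥ z - z ⬝ᵥ F *ᵥ (c • x) := by rw [e1, e2]; ring
        _ = T / Real.pi * (∫ ξ in Set.Ioi 0, slotSpec ρ ξ * ((c • x) ⬝ᵥ (Rξ ξ) *ᵥ z)) -
              T / Real.pi * (∫ ξ in Set.Ioi 0, slotSpec ρ ξ * (z ⬝ᵥ (Rξ ξ) *ᵥ (c • x))) := by rw [I1.2, I2.2]
        _ = _ := by rw [MeasureTheory.integral_sub I1.1 I2.1, mul_sub]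
    have rhs : |τ| * ((c ^ 2 * (x ⬝ᵥ F *ᵥ x) + z ⬝ᵥ F *ᵥ z) / 2) = T / Real.pi *
        ∫ ξ in Set.Ioi 0, |τ| / 2 * (slotSpec ρ ξ * ((c • x) ⬝ᵥ (Rξ ξ) *ᵥ (c • x)) + slotSpec ρ ξ * (z ⬝ᵥ (Rξ ξ) *ᵥ z)) :=
      calc |τ| * ((c ^ 2 * (x ⬝ᵥ F *ᵥ x) + z ⬝ᵥ F *ᵥ z) / 2) = |τ| / 2 * ((c • x) ⬝ᵥ F *ᵥ (c • x) + z ⬝ᵥ F *ᵥ z) := by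
            rw [e3]; ring
        _ = |τ| / 2 * (T / Real.pi * (∫ ξ in Set.Ioi 0, slotSpec ρ ξ * ((c • x) ⬝ᵥ (Rξ ξ) *ᵥ (c • x))) +
              T / Real.pi * (∫ ξ in Set.Ioi 0, slotSpec ρ ξ * (z ⬝ᵥ (Rξ ξ) *ᵥ z))) := by rw [← I3.2, ← I4.2]
        _ = _ := by rw [MeasureTheory.integral_const_mul, MeasureTheory.integral_add I3.1 I4.1]; ring
    rw [lhs, rhs]
    refine mul_le_mul_of_nonneg_left ?_ hTpi
    refine MeasureTheory.setIntegral_mono_on (I1.1.sub I2.1) ((I3.1.add I4.1).const_mul _) measurableSet_Ioi fun ξ _ => ?_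
    -- pointwise: Â·σ_R(cx, z) ≤ (|τ|/2)·Â·(Q_R(cx) + Q_R(z))
    have hA := slotSpec_nonneg ρ ξ
    obtain ⟨hsq, hq1⟩ := atom ξ (c • x) z
    have hq2 := (atom ξ z z).2
    -- |σ| ≤ |τ| √(Q₁Q₂) ≤ |τ|(Q₁+Q₂)/2, via squares
    have hσ : (c • x) ⬝ᵥ (Rξ ξ) *ᵥ z - z ⬝ᵥ (Rξ ξ) *ᵥ (c • x) ≤
        |τ| / 2 * ((c • x) ⬝ᵥ (Rξ ξ) *ᵥ (c • x) + z ⬝ᵥ (Rξ ξ) *ᵥ z) := by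
      have hsq' : ((c • x) ⬝ᵥ (Rξ ξ) *ᵥ z - z ⬝ᵥ (Rξ ξ) *ᵥ (c • x)) ^ 2 ≤
          (|τ| / 2 * ((c • x) ⬝ᵥ (Rξ ξ) *ᵥ (c • x) + z ⬝ᵥ (Rξ ξ) *ᵥ z)) ^ 2 := by
        refine hsq.trans ?_
        have hτ2 : τ ^ 2 = |τ| ^ 2 := (sq_abs τ).symm
        rw [hτ2]
        nlinarith [sq_nonneg ((c • x) ⬝ᵥ (Rξ ξ) *ᵥ (c • x) - z ⬝ᵥ (Rξ ξ) *ᵥ z), sq_nonneg |τ|, abs_nonneg τ,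
          mul_nonneg (sq_nonneg |τ|) (sq_nonneg ((c • x) ⬝ᵥ (Rξ ξ) *ᵥ (c • x) - z ⬝ᵥ (Rξ ξ) *ᵥ z))]
      exact (abs_le_of_sq_le_sq' hsq' (by positivity)).2
    have := mul_le_mul_of_nonneg_left hσ hA
    nlinarith [this]
  have h := sq_le_of_forall_scale (hQnn x) (hQnn z) key
  rwa [sq_abs] at h

end SectorAtoms

end Summit.AnomalousDissipation.AnomalousDissipation.Theorems.SolenoidalFractalHomogenisation.LagrangianStep.OddGain

end
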